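import Literature.Computability.Complexity.CircuitComposition
import Literature.Computability.QuantumComplexity.WireConjugation
import Literature.Computability.QuantumComplexity.RevGadgets
import Literature.Computability.Cryptography.QuantumCircuitProofs
import Literature.Computability.Cryptography.QubitRegisterCliffordTProofs
import Literature.Computability.MetaComplexity.GGM
import Literature.Computability.Complexity.PNPNaturalProofsProofs
import Literature.Computability.QuantumComplexity.PolyMajority
import Literature.Barriers.QuantumAdvantage.NaturalProofsScope
import Literature.Barriers.PneNP.NaturalProofs
import Literature.Computability.Cryptography.ClassBQPProofs
import Literature.Computability.QuantumComplexity.SimUniformity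
import HarnessLib

/-!
# Barrier catalogue `QuantumAdvantage`: natural proofs with QUANTUM constructivity (Razborov–Rudich with a quantum test)

D-0021 barrier entry for the summit `QuantumAdvantage` (`∃ L, L ∈ BQP ∧ L ∉ BPP`), bearing on its
circuit strengthening `BQP ⊄ P/poly` (route `CircuitLB`) and, specifically, on the door that the
audit file `NaturalProofsScope.lean` left open: the classical entry `NaturalProofs` /
`NaturalProofsNarrow` (Razborov–Rudich 1997, Thm. 4.1, PROVED in the tree) bars `Γ`-natural
properties useful against `P/poly` only for constructivity classes `Γ ⊆ P/poly`, and under its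
CLASSICAL hypothesis `Literature.Barriers.PneNP.HardPRGExist` a QUANTUM natural property
(`Γ = BQP`: the truth-table language decided in bounded-error quantum polynomial time in `N = 2ⁿ`;
Arunachalam–Grilo–Gur–Oliveira–Sundaram 2021, Def. 10 with `𝔇 = BQP`) useful against `P/poly`
is not barred but would PROVE the summit (`exists_mem_bqp_not_mem_bpp_of_quantumNatural`,
`quantumNatural_dichotomy`). That file records what does obstruct quantum natural properties as "a
different hypothesis, not vendored in the tree: pseudorandom functions in `P/poly` secure against
QUANTUM `2^{O(n)}`-size distinguishers (the RR/GGM argument run with a quantum test)". This file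
vendors that hypothesis and PROVES the corresponding barrier.

**The printed results.**

* Razborov–Rudich, *Natural proofs*, JCSS 55 (1997), Thm. 4.1 and its proof (GGM pseudo-random
  functions from the generator, hybrid argument; tree: `Literature.Computability.MetaComplexity.GGM`,
  `Literature.Computability.Complexity.natural_proofs_barrier_holds`) [RazborovRudich1997]; the
  account of Arora–Barak, Ch. 23, Thm. 23.1 and §23.3 (PDF pp. 587, 591–592) [AroraBarakCC2009].
* Chia–Chou–Zhang–Zhang, *Quantum meets the minimum circuit size problem*, ITCS 2022
  (arXiv:2108.03171), §4.1.1: Def. 4.1 (PRG), Def. 4.2 ("`G` is a pseudorandom generator secure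
  against quantum adversaries … for all quantum polynomial-time algorithm `𝒜` …
  `|Pr[𝒜(G(x)) = 1] − Pr[𝒜(y) = 1]| ≤ ε(n)`"), Def. 4.3 (GGM), Lemma 4.4–4.5 (HILL, black-box, hence
  quantum), Lemma 4.6 (from a qPRG `G : {0,1}ⁿ → {0,1}²ⁿ` the local qPRG `Ĝ(x) = h_x(0)|…|h_x(2^m−1)`,
  "indistinguishable from a truly random string by the standard hybrid approach … `H^i(z)` … there
  exists `i*` such that … distinguishing `Ĝ^{i*}` and `Ĝ^{i*+1}` implies that one can distinguish
  `G(x)` from a random string"); §4.1.2, Thm. 1.4: "If `MQCSP ∈ BQP`, then there is no quantum-secure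
  one-way function", proof = Algorithm 1 "A quantum algorithm for breaking qPRG: Given `T(h)` …
  Runs the quantum algorithm for MQCSP …" [ChiaChouZhangZhang2022] — the quantum reading of
  Kabanets–Cai / Razborov–Rudich, in the polynomial, uniform regime.
* Arunachalam–Grilo–Gur–Oliveira–Sundaram, *Quantum learning algorithms imply circuit lower bounds*,
  FOCS 2021 (arXiv:2012.01920), §2.4 Def. 10 ("`𝔇` a (uniform or non-uniform) complexity class …
  `Γ` is a `𝔇`-natural property useful against `𝒞[s]` … If `𝔇 = BQP`, we say that `Γ` is a quantum
  natural property … the corresponding algorithm is allowed to run in time polynomial in the input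
  length `N = 2ⁿ`"), Def. 11–12 (promise quantum natural properties), §2.6 ("a distribution `𝒟`
  supported over `{0,1}^m` is `(s, ε)`-pseudorandom against quantum circuits if for every quantum
  circuit `C` of size `s` defined over `m` input bits `|Pr_{x,C}[C(x) = 1] − Pr_{y∼𝒟,C}[C(y) = 1]| ≤ ε`
  … each probability refers to an appropriate random input and the randomness present in the output
  of `C`"), §1.4 Question 2, §3.2 [ArunachalamGriloGurOliveiraSundaram2021].
* Bennett–Bernstein–Brassard–Vazirani 1997, Thm. 4.13 (majority-vote error reduction; tree
  `Literature.Computability.QuantumComplexity.PolyCopies.…`, `exists_poly_amplified`)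
  [BennettBernsteinBrassardVazirani1997]; Nielsen–Chuang §3.2.5, §4.3 (reversible classical
  computation by `NOT`/`CNOT`/Toffoli inside a quantum circuit; tree `revCompile`) [NielsenChuang2010].
* Candidates for the hypothesis: Banerjee–Peikert–Rosen, EUROCRYPT 2012, abstract and §1.1 (PRFs
  from LWE "in NC¹ or even TC⁰ … the first low-depth PRFs that have no known attack by efficient
  quantum algorithms"; "LWR may be exponentially hard (even for quantum algorithms) … immediately
  yields a simple and practical pseudorandom generator") [BanerjeePeikertRosen2012]; Zhandry, FOCS
  2012 (GGM secure against quantum adversaries from a quantum-secure generator) [Zhandry2012].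

**What this file adds (everything PROVED; no unproved `def … : Prop` — the quantum twin of
`HardPRGExist` is an inline hypothesis here).**

* `quantumPrgAdvantage`, `quantumPrgHardness` — Razborov–Rudich's advantage and hardness `H(G)`
  (tree `prgAdvantage`, `prgHardness`) with the `B₂`-circuit distinguisher replaced by an oracle-free
  Clifford+`T` circuit fed the string as classical input `|y⟩|0…0⟩` and read on wire `0`
  (Arunachalam et al. §2.6); the hypothesis `QHG` "a `2^{k^ε}`-quantum-hard generator family in
  `P/poly` exists" is NOT vendored as a fact (it is unproved): it is taken inline by the no-go
  theorems and is to be registered by name as the obligation `QuantumHardPRGExist` (conjecture leaf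
  under `Summits/`).
* The technical core, all in the vocabulary of the tree's quantum circuit model
  (`Cryptography/QuantumCircuit.lean`) and straight-line `B₂` circuits (`Complexity/Circuit*.lean`):
  `RevB2.compile` (a `B₂` gate list compiled into a `NOT`/`CNOT`/Toffoli program, one fresh wire per
  gate, algebraic normal form per gate; `RevB2.clEval_compile`), the distinguisher circuit
  `QDist.Params.circuit` (move the input out of the front block, compute the gates, copy the outputs
  into the block, run the quantum test placed on the block; `QDist.Params.acceptProb_circuit`:
  it accepts `z` exactly with the probability that the test accepts `F z`), the finite core
  `quantumPrgHardness_le_of_qtest` (the hybrid lemma `exists_distinguisher` of `GGM.lean` applied to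
  the Boolean event "accepted with probability `≥ 1 − η`", then `expectation_gap_of_threshold`), the
  amplified test `qtest_of_isConstructive`, and the asymptotic assembly
  `quantum_natural_proofs_barrier_fixedExponent` / `quantum_natural_proofs_barrier` (a line-by-line
  twin of `natural_proofs_barrier_fixedExponent`).
* The catalogue entry `QuantumNaturalProofs` (BARRIER block) with `QuantumNaturalProofs_holds`, and
  the no-go readings `no_quantumNatural_of_qHardPRG`, `exists_exponent_no_quantumNatural_of_qHardPRG`,
  `no_natural_of_subset_BQP` (`Γ = P`, `BPP`, …, `BQP`), `quantumNatural_door_closed`,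
  `not_quantumHard_of_quantumNatural`.
* A `B₂`-circuit test is a quantum test (`quantumPrgHardness_le_of_circuit`: compile the circuit
  reversibly, measure the output wire), hence `H(g) ≥ N'` whenever `H_q(g) ≥ 24(2m + 4N' + 1)`
  (`le_prgHardness_of_le_quantumPrgHardness`), `QHG` ⟹ `Literature.Barriers.PneNP.HardPRGExist`
  (`hardPRGExist_of_qHardPRG`, exponent `ε/2`), and under `QHG` the CLASSICAL entry applies as
  well: no `P/poly`-natural property is useful against `P/poly` (`no_naturalProof_of_qHardPRG`).

**Design notes.** (1) The quantum test enters only through its acceptance probabilities on basis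
states; no superposition query to the pseudo-random function is made (the truth table of the hybrid
is computed classically from the challenge inside the circuit), so Zhandry's quantum-query security
of GGM is not needed — only generator security against quantum CIRCUITS, exactly RR's hypothesis
with quantum distinguishers. (2) The Boolean hybrid lemma of `GGM.lean` is reused verbatim by
thresholding the amplified test at `1 − η`; converting the thresholded gap back into an expectation
gap costs `2η`, which is why the test is first amplified to error `2^{-(c₁+2)n}/4` (inverse
polynomial in `N = 2ⁿ`, `PolyMajority.lean`). This is also why PROMISE quantum natural properties
(Arunachalam et al. Def. 12) are not covered by the proof as given (see `scope_caveats`). (3) The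
classical preprocessing is compiled gate by gate into Toffoli/`CNOT`/`NOT` (`≤ 4` operations per
`B₂` gate, `≤ 24` Clifford+`T` gates per operation, `length_revCompile_le`), so all sizes stay
`2^{O(n)}`.

Deliberately NOT here: the named hypothesis `QuantumHardPRGExist` (an obligation, not literature);
the converse "`HardPRGExist` ⟹ `QHG`" (false in general: a quantum distinguisher need not be
classical); promise / non-uniform (`BQP/qpoly`) quantum constructivity; Zhandry's quantum-query PRF
security.
-/

noncomputable section

namespace Literature.Barriers.QuantumAdvantage

open _root_.Computability Literature.Computability.Complexity Literature.Computability.Complexity.GateList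
  Literature.Computability.QuantumComplexity Literature.Computability.Cryptography
  Literature.Computability.MetaComplexity Literature.Computability.AlgebraicComplexity Function Finset Matrix Filter

namespace RevB2

variable {ι κ : Type*} [DecidableEq κ]

/-- A naming of the wires of a straight-line program inside a register with wires of type `κ`:
the input variable `i` lives on wire `inW i`, the value of gate number `m` is computed on wire
`gW m`. [folklore] -/
structure Naming (ι κ : Type*) where
  /-- the wire holding input variable `i` -/
  inW : ι → κ
  /-- the wire on which the value of gate number `m` is computed -/
  gW : ℕ → κ

/-- The wire named by a wire of the straight-line program (`inl i` an input, `inr m` a gate). [folklore] -/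
def Naming.wire (nm : Naming ι κ) : ι ⊕ ℕ → κ := Sum.elim nm.inW nm.gW

omit [DecidableEq κ] in
/-- An input wire of the program is named by `inW`. [folklore] -/
@[simp] theorem Naming.wire_inl (nm : Naming ι κ) (i : ι) : nm.wire (Sum.inl i) = nm.inW i := rfl

omit [DecidableEq κ] in
/-- A gate wire of the program is named by `gW`. [folklore] -/
@[simp] theorem Naming.wire_inr (nm : Naming ι κ) (m : ℕ) : nm.wire (Sum.inr m) = nm.gW m := rfl

/-- The program writing `c₀ ⊕ c₁·a` onto the (fresh) target `t`: an optional `NOT t` and an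
optional `CNOT a t` (algebraic normal form of a unary Boolean function).
[cite: NielsenChuang2010, §3.2.5] -/
def affOps (c₀ c₁ : Bool) (a t : κ) : List (ClOp κ) :=
  (if c₀ then [ClOp.not t] else []) ++ (if c₁ then [ClOp.cnot a t] else [])

/-- The program writing `c₀ ⊕ c₁·a ⊕ c₂·b ⊕ c₃·ab` onto the (fresh) target `t` (algebraic normal
form of a binary Boolean function; when the two argument wires coincide the Toffoli gate is
replaced by a `CNOT`, so that all operations are well formed). [cite: NielsenChuang2010, §3.2.5] -/
def binOps (c₀ c₁ c₂ c₃ : Bool) (a b t : κ) : List (ClOp κ) :=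
  affOps c₀ c₁ a t ++ ((if c₂ then [ClOp.cnot b t] else []) ++
    (if c₃ then (if a = b then [ClOp.cnot a t] else [ClOp.toffoli a b t]) else []))

/-- The reversible program for gate number `j` of a straight-line program: for a gate of fan-in
`≤ 2` the algebraic normal form of its truth table, written with `NOT`/`CNOT`/Toffoli onto the
fresh wire `gW j`, the arguments being read on the wires named by the gate's argument wires;
gates of fan-in `≥ 3` (absent over `B₂`) compile to nothing. [cite: NielsenChuang2010, §3.2.5] [cite: AroraBarakCC2009, §10.3.7 (Lemma 10.10)] -/
def gateOps (nm : Naming ι κ) (j : ℕ) : Gate ι → List (ClOp κ)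
  | ⟨0, op, _⟩ => if op Fin.elim0 then [ClOp.not (nm.gW j)] else []
  | ⟨1, op, args⟩ =>
      affOps (op fun _ => false) (xor (op fun _ => true) (op fun _ => false))
        (nm.wire (args 0)) (nm.gW j)
  | ⟨2, op, args⟩ =>
      binOps (op fun i => if i = 0 then false else false)
        (xor (op fun i => if i = 0 then true else false) (op fun i => if i = 0 then false else false))
        (xor (op fun i => if i = 0 then false else true) (op fun i => if i = 0 then false else false))
        (xor (xor (op fun i => if i = 0 then true else true) (op fun i => if i = 0 then true else false))
          (xor (op fun i => if i = 0 then false else true) (op fun i => if i = 0 then false else false)))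
        (nm.wire (args 0)) (nm.wire (args 1)) (nm.gW j)
  | ⟨_ + 3, _, _⟩ => []

/-- Compilation of a straight-line program from gate number `j` on. [folklore] -/
def compileFrom (nm : Naming ι κ) : ℕ → List (Gate ι) → List (ClOp κ)
  | _, [] => []
  | j, g :: gs => gateOps nm j g ++ compileFrom nm (j + 1) gs

/-- **Compilation of a `B₂` straight-line program into a `NOT`/`CNOT`/Toffoli program**, gate by
gate onto fresh wires ("replace each Boolean gate by its reversible analogue computing its value
into a fresh zero bit"). [cite: AroraBarakCC2009, §10.3.7 (Lemma 10.10)] [cite: NielsenChuang2010, §3.2.5] -/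
def compile (nm : Naming ι κ) (gs : List (Gate ι)) : List (ClOp κ) := compileFrom nm 0 gs

/-! #### Lengths -/

omit [DecidableEq κ] in
/-- `affOps` has at most `2` operations. [folklore] -/
theorem length_affOps_le (c₀ c₁ : Bool) (a t : κ) : (affOps c₀ c₁ a t).length ≤ 2 := by
  unfold affOps; cases c₀ <;> cases c₁ <;> simp

/-- `binOps` has at most `4` operations. [folklore] -/
theorem length_binOps_le (c₀ c₁ c₂ c₃ : Bool) (a b t : κ) : (binOps c₀ c₁ c₂ c₃ a b t).length ≤ 4 := by
  unfold binOps
  simp only [List.length_append]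
  have h1 := length_affOps_le c₀ c₁ a t
  have h2 : (if c₂ then [ClOp.cnot b t] else []).length ≤ 1 := by split_ifs <;> simp
  have h3 : (if c₃ then (if a = b then [ClOp.cnot a t] else [ClOp.toffoli a b t]) else []).length ≤ 1 := by
    split_ifs <;> simp
  omega

/-- Every gate compiles to at most `4` operations. [folklore] -/
theorem length_gateOps_le (nm : Naming ι κ) (j : ℕ) (g : Gate ι) : (gateOps nm j g).length ≤ 4 := by
  obtain ⟨ar, op, args⟩ := g
  match ar, op, args with
  | 0, op, args => simp only [gateOps]; split_ifs <;> simp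
  | 1, op, args => exact (length_affOps_le _ _ _ _).trans (by norm_num)
  | 2, op, args => exact length_binOps_le _ _ _ _ _ _ _
  | _ + 3, op, args => simp [gateOps]

/-- `compileFrom` has at most `4` operations per gate. [folklore] -/
theorem length_compileFrom_le (nm : Naming ι κ) :
    ∀ (j : ℕ) (gs : List (Gate ι)), (compileFrom nm j gs).length ≤ 4 * gs.length
  | _, [] => by simp [compileFrom]
  | j, g :: gs => by
    rw [compileFrom, List.length_append, List.length_cons]
    have h1 := length_gateOps_le nm j g
    have h2 := length_compileFrom_le nm (j + 1) gs
    omega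

/-- **The compiled program has at most `4` operations per gate.** [cite: AroraBarakCC2009, §10.3.7 (Lemma 10.10: "size O(|C|)")] -/
theorem length_compile_le (nm : Naming ι κ) (gs : List (Gate ι)) :
    (compile nm gs).length ≤ 4 * gs.length :=
  length_compileFrom_le nm 0 gs

/-- Compiling one more gate appends its operations. [folklore] -/
theorem compileFrom_append_singleton (nm : Naming ι κ) (g : Gate ι) :
    ∀ (j : ℕ) (gs : List (Gate ι)),
      compileFrom nm j (gs ++ [g]) = compileFrom nm j gs ++ gateOps nm (j + gs.length) g
  | j, [] => by simp [compileFrom]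
  | j, g' :: gs => by
    rw [List.cons_append, compileFrom, compileFrom, compileFrom_append_singleton nm g (j + 1) gs,
      List.append_assoc, List.length_cons]
    congr 3
    omega

/-- Compiling one more gate appends its operations (from gate `0`). [folklore] -/
theorem compile_append_singleton (nm : Naming ι κ) (gs : List (Gate ι)) (g : Gate ι) :
    compile nm (gs ++ [g]) = compile nm gs ++ gateOps nm gs.length g := by
  rw [compile, compileFrom_append_singleton, Nat.zero_add]; rfl

/-! #### Semantics of one gate -/

/-- Semantics of `affOps` on a target distinct from the argument. [folklore] -/
theorem clEval_affOps (c₀ c₁ : Bool) {a t : κ} (hat : a ≠ t) (w : κ → Bool) :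
    clEval (affOps c₀ c₁ a t) w = update w t (xor (w t) (xor c₀ (c₁ && w a))) := by
  funext i
  unfold affOps
  by_cases hi : i = t
  · subst hi
    cases c₀ <;> cases c₁ <;>
      simp [clEval_cons, ClOp.eval_not, ClOp.eval_cnot, update_self, update_of_ne hat]
  · cases c₀ <;> cases c₁ <;>
      simp [clEval_cons, ClOp.eval_not, ClOp.eval_cnot, update_of_ne hi]

/-- Semantics of `binOps` on a target distinct from both arguments. [folklore] -/
theorem clEval_binOps (c₀ c₁ c₂ c₃ : Bool) {a b t : κ} (hat : a ≠ t) (hbt : b ≠ t) (w : κ → Bool) :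
    clEval (binOps c₀ c₁ c₂ c₃ a b t) w =
      update w t (xor (w t) (xor (xor c₀ (c₁ && w a)) (xor (c₂ && w b) (c₃ && (w a && w b))))) := by
  unfold binOps
  rw [clEval_append, clEval_affOps c₀ c₁ hat, clEval_append]
  funext i
  by_cases hi : i = t
  · subst hi
    by_cases hab : a = b
    · subst hab
      cases c₂ <;> cases c₃ <;> cases hwa : w a <;> cases hw : w i <;> cases c₀ <;> cases c₁ <;>
        simp [clEval_cons, ClOp.eval_cnot, update_self, update_of_ne hat, hwa]
    · cases c₂ <;> cases c₃ <;> cases hwa : w a <;> cases hwb : w b <;> cases hw : w i <;> cases c₀ <;> cases c₁ <;>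
        simp [clEval_cons, ClOp.eval_cnot, ClOp.eval_toffoli, update_self, update_of_ne hat,
          update_of_ne hbt, hwa, hwb, hab]
  · by_cases hab : a = b
    · subst hab
      cases c₂ <;> cases c₃ <;> simp [clEval_cons, ClOp.eval_cnot, update_of_ne hi]
    · cases c₂ <;> cases c₃ <;>
        simp [clEval_cons, ClOp.eval_cnot, ClOp.eval_toffoli, update_of_ne hi, hab]

/-- Algebraic normal form of a unary Boolean function. [folklore] -/
theorem anf₁ (op : (Fin 1 → Bool) → Bool) (v : Fin 1 → Bool) :
    op v = xor (op fun _ => false) ((xor (op fun _ => true) (op fun _ => false)) && v 0) := by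
  obtain ⟨x, rfl⟩ : ∃ x : Bool, v = fun _ => x := ⟨v 0, funext fun i => by rw [Subsingleton.elim i 0]⟩
  cases x
  all_goals
    generalize op (fun _ => true) = p
    generalize op (fun _ => false) = q
    cases p <;> cases q <;> decide

/-- Algebraic normal form of a binary Boolean function. [folklore] -/
theorem anf₂ (op : (Fin 2 → Bool) → Bool) (v : Fin 2 → Bool) :
    op v = xor (xor (op fun i => if i = 0 then false else false)
        ((xor (op fun i => if i = 0 then true else false) (op fun i => if i = 0 then false else false)) && v 0))
      (xor ((xor (op fun i => if i = 0 then false else true) (op fun i => if i = 0 then false else false)) && v 1)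
        ((xor (xor (op fun i => if i = 0 then true else true) (op fun i => if i = 0 then true else false))
          (xor (op fun i => if i = 0 then false else true) (op fun i => if i = 0 then false else false))) &&
          (v 0 && v 1))) := by
  obtain ⟨x, y, rfl⟩ : ∃ x y : Bool, v = fun i => if i = 0 then x else y :=
    ⟨v 0, v 1, funext fun i => by fin_cases i <;> simp⟩
  cases x <;> cases y
  all_goals
    generalize op (fun i => if i = 0 then false else false) = p00
    generalize op (fun i => if i = 0 then true else false) = p10
    generalize op (fun i => if i = 0 then false else true) = p01
    generalize op (fun i => if i = 0 then true else true) = p11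
    cases p00 <;> cases p10 <;> cases p01 <;> cases p11 <;> decide

/-- **Semantics of a compiled gate.** If the target wire `gW j` is fresh (`0`) and distinct from
the wires of the arguments, the compiled gate writes the value of the gate (read on the named
argument wires) onto `gW j` and changes nothing else. [cite: NielsenChuang2010, §3.2.5] -/
theorem clEval_gateOps (nm : Naming ι κ) (j : ℕ) (g : Gate ι) (hB : g.fn ∈ B2) (w : κ → Bool)
    (ht : w (nm.gW j) = false) (hne : ∀ a, nm.wire (g.args a) ≠ nm.gW j) :
    clEval (gateOps nm j g) w = update w (nm.gW j) (g.op fun a => w (nm.wire (g.args a))) := by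
  obtain ⟨ar, op, args⟩ := g
  match ar, op, args, hB, hne with
  | 0, op, args, _, _ =>
    have hv : (fun a => w (nm.wire (args a))) = Fin.elim0 := funext fun a => a.elim0
    simp only [gateOps, hv]
    funext i
    by_cases hi : i = nm.gW j
    · subst hi
      cases hop : op Fin.elim0
      · simp [ht]
      · simp [clEval_cons, ClOp.eval_not, ht]
    · cases hop : op Fin.elim0
      · simp [update_of_ne hi]
      · simp [clEval_cons, ClOp.eval_not, update_of_ne hi]
  | 1, op, args, _, hne =>
    simp only [gateOps]
    rw [clEval_affOps _ _ (hne 0), ht, Bool.false_xor]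
    exact congrArg _ (anf₁ op fun a => w (nm.wire (args a))).symm
  | 2, op, args, _, hne =>
    simp only [gateOps]
    rw [clEval_binOps _ _ _ _ (hne 0) (hne 1), ht, Bool.false_xor]
    exact congrArg _ (anf₂ op fun a => w (nm.wire (args a))).symm
  | k + 3, op, args, hB, _ =>
    exfalso
    change k + 3 ≤ 2 at hB
    omega

/-- The operations of a compiled gate are well formed (pairwise distinct wires) as soon as the
target is distinct from the argument wires. [folklore] -/
theorem wf_gateOps (nm : Naming ι κ) (j : ℕ) (g : Gate ι)
    (hne : ∀ a, nm.wire (g.args a) ≠ nm.gW j) : ∀ o ∈ gateOps nm j g, o.WF := by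
  obtain ⟨ar, op, args⟩ := g
  match ar, op, args, hne with
  | 0, op, args, _ =>
    intro o ho
    simp only [gateOps] at ho
    split_ifs at ho <;> simp at ho
    subst ho; trivial
  | 1, op, args, hne =>
    intro o ho
    simp only [gateOps, affOps, List.mem_append] at ho
    rcases ho with ho | ho <;> split_ifs at ho <;> simp at ho <;> subst ho
    · trivial
    · exact hne 0
  | 2, op, args, hne =>
    intro o ho
    simp only [gateOps, binOps, affOps, List.mem_append] at ho
    rcases ho with (ho | ho) | (ho | ho)
    · split_ifs at ho <;> simp at ho; subst ho; trivial
    · split_ifs at ho <;> simp at ho; subst ho; exact hne 0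
    · split_ifs at ho <;> simp at ho; subst ho; exact hne 1
    · split_ifs at ho with h1 h2 <;> simp at ho <;> subst ho
      · exact hne 0
      · exact ⟨h2, hne 0, hne 1⟩
  | k + 3, op, args, _ => simp [gateOps]

/-- Every operation of a compiled gate targets `gW j`. [folklore] -/
theorem target_of_mem_gateOps (nm : Naming ι κ) (j : ℕ) (g : Gate ι) :
    ∀ o ∈ gateOps nm j g, o.target = nm.gW j := by
  obtain ⟨ar, op, args⟩ := g
  match ar, op, args with
  | 0, op, args =>
    intro o ho
    simp only [gateOps] at ho
    split_ifs at ho <;> simp at ho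
    subst ho; rfl
  | 1, op, args =>
    intro o ho
    simp only [gateOps, affOps, List.mem_append] at ho
    rcases ho with ho | ho <;> split_ifs at ho <;> simp at ho <;> subst ho <;> rfl
  | 2, op, args =>
    intro o ho
    simp only [gateOps, binOps, affOps, List.mem_append] at ho
    rcases ho with (ho | ho) | (ho | ho) <;> split_ifs at ho <;> simp at ho <;> subst ho <;> rfl
  | k + 3, op, args => simp [gateOps]

/-! #### Semantics of the compiled program -/

/-- **Correctness of the compilation.** Let the gate wires `gW m`, `m < |gs|`, be pairwise distinct
and distinct from the input wires. Run the compiled program on an assignment carrying the input `x`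
on the input wires and `0` on the gate wires. Then afterwards the input wires still carry `x`, gate
wire `gW m` carries the value of gate `m` of the straight-line program on `x`, and every other wire
is unchanged. [cite: AroraBarakCC2009, §10.3.7 (Lemma 10.10)] [cite: NielsenChuang2010, §3.2.5] -/
theorem clEval_compile (nm : Naming ι κ) (x : ι → Bool) :
    ∀ (gs : List (Gate ι)), WF gs → (∀ g ∈ gs, g.fn ∈ B2) →
      (∀ m < gs.length, ∀ m' < gs.length, nm.gW m = nm.gW m' → m = m') →
      (∀ i, ∀ m < gs.length, nm.inW i ≠ nm.gW m) →
      ∀ w₀ : κ → Bool, (∀ i, w₀ (nm.inW i) = x i) → (∀ m < gs.length, w₀ (nm.gW m) = false) →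
        (∀ i, clEval (compile nm gs) w₀ (nm.inW i) = x i) ∧
        (∀ m < gs.length, clEval (compile nm gs) w₀ (nm.gW m) = (vals gs x).getD m false) ∧
        (∀ c, (∀ i, c ≠ nm.inW i) → (∀ m < gs.length, c ≠ nm.gW m) →
          clEval (compile nm gs) w₀ c = w₀ c) := by
  intro gs
  induction gs using List.reverseRecOn with
  | nil =>
    intro _ _ _ _ w₀ hin _
    simp [compile, compileFrom, hin]
  | append_singleton gs g ih =>
    intro hwf hB hinj hdisj w₀ hin hz
    have hlen : (gs ++ [g]).length = gs.length + 1 := by simp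
    rw [hlen] at hinj hdisj hz
    rw [hlen]
    set L := gs.length with hL
    have hwf' : WF gs := hwf.of_append_left
    have hgOK : GateOK L g := hwf.getLast
    have hB' : ∀ g' ∈ gs, g'.fn ∈ B2 := fun g' hg' => hB g' (List.mem_append_left _ hg')
    have hBg : g.fn ∈ B2 := hB g (by simp)
    obtain ⟨h1, h2, h3⟩ := ih hwf' hB'
      (fun m hm m' hm' e => hinj m (by omega) m' (by omega) e)
      (fun i m hm => hdisj i m (by omega)) w₀ hin (fun m hm => hz m (by omega))
    set w₁ := clEval (compile nm gs) w₀ with hw₁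
    -- the target of the new gate is fresh and distinct from everything read so far
    have hgL : ∀ m < L, nm.gW m ≠ nm.gW L := fun m hm e => by
      have := hinj m (by omega) L (by omega) e; omega
    have ht : w₁ (nm.gW L) = false := by
      rw [h3 (nm.gW L) (fun i e => hdisj i L (by omega) e.symm) (fun m hm e => hgL m hm e.symm)]
      exact hz L (by omega)
    have hne : ∀ a, nm.wire (g.args a) ≠ nm.gW L := fun a => by
      cases ha : g.args a with
      | inl i => simpa using hdisj i L (by omega)
      | inr m => simpa using hgL m (hgOK a m ha)
    -- the new gate reads the correct values
    have hval : (fun a => w₁ (nm.wire (g.args a))) = fun a => wireOf x (vals gs x) (g.args a) := by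
      funext a
      cases ha : g.args a with
      | inl i => simp [h1 i]
      | inr m => simp [h2 m (hgOK a m ha)]
    rw [compile_append_singleton, clEval_append, ← hw₁, clEval_gateOps nm L g hBg w₁ ht hne, hval,
      vals_append_singleton]
    refine ⟨fun i => ?_, fun m hm => ?_, fun c hc1 hc2 => ?_⟩
    · rw [update_of_ne (hdisj i L (by omega)), h1 i]
    · rcases Nat.lt_or_ge m L with hmL | hmL
      · rw [update_of_ne (hgL m hmL), h2 m hmL, List.getD_eq_getElem?_getD, List.getD_eq_getElem?_getD,
          List.getElem?_append_left (by simpa using hmL)]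
      · obtain rfl : m = L := by omega
        rw [update_self, List.getD_eq_getElem?_getD, List.getElem?_append_right (by simp [hL]),
          length_vals, Nat.sub_self]
        simp
    · rw [update_of_ne (hc2 L (by omega)), h3 c hc1 (fun m hm => hc2 m (by omega))]

/-- All operations of the compiled program are well formed. [folklore] -/
theorem wf_compile (nm : Naming ι κ) :
    ∀ (gs : List (Gate ι)), WF gs →
      (∀ m < gs.length, ∀ m' < gs.length, nm.gW m = nm.gW m' → m = m') →
      (∀ i, ∀ m < gs.length, nm.inW i ≠ nm.gW m) →
      ∀ o ∈ compile nm gs, o.WF := by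
  intro gs
  induction gs using List.reverseRecOn with
  | nil => intro _ _ _ o ho; simp [compile, compileFrom] at ho
  | append_singleton gs g ih =>
    intro hwf hinj hdisj o ho
    have hlen : (gs ++ [g]).length = gs.length + 1 := by simp
    rw [hlen] at hinj hdisj
    rw [compile_append_singleton, List.mem_append] at ho
    rcases ho with ho | ho
    · exact ih hwf.of_append_left (fun m hm m' hm' e => hinj m (by omega) m' (by omega) e)
        (fun i m hm => hdisj i m (by omega)) o ho
    · refine wf_gateOps nm _ g (fun a => ?_) o ho
      cases ha : g.args a with
      | inl i => simpa using hdisj i gs.length (by omega)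
      | inr m =>
        have hm : m < gs.length := hwf.getLast a m ha
        simp only [Naming.wire_inr]
        intro e
        have := hinj m (by omega) gs.length (by omega) e
        omega

/-- Every operation of the compiled program targets a gate wire. [folklore] -/
theorem target_of_mem_compile (nm : Naming ι κ) :
    ∀ (gs : List (Gate ι)), ∀ o ∈ compile nm gs, ∃ m < gs.length, o.target = nm.gW m := by
  intro gs
  induction gs using List.reverseRecOn with
  | nil => intro o ho; simp [compile, compileFrom] at ho
  | append_singleton gs g ih =>
    intro o ho
    rw [compile_append_singleton, List.mem_append] at ho
    rcases ho with ho | ho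
    · obtain ⟨m, hm, e⟩ := ih o ho
      exact ⟨m, by rw [List.length_append, List.length_singleton]; omega, e⟩
    · exact ⟨gs.length, by rw [List.length_append, List.length_singleton]; omega,
        target_of_mem_gateOps nm _ g o ho⟩

end RevB2


/-! ### From a thresholded gap to an expectation gap -/

/-- **From a gap in threshold counts to a gap in expectations.** Let `u`, `v` be `[0,1]`-valued
functions on finite sets (acceptance probabilities of a bounded-error test on two distributions)
with the threshold property "every value is `≤ η` or `≥ 1 - η`" on the `v`-side. Then the
difference of the means of `u` and `v` is at least the difference of the densities of the
super-threshold sets minus `2η`. [folklore] -/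
theorem expectation_gap_of_threshold {α β : Type*} [Fintype α] [Fintype β] [Nonempty α] [Nonempty β]
    {u : α → ℝ} {v : β → ℝ} {η : ℝ} (hη : 0 ≤ η) (hu : ∀ a, 0 ≤ u a) (hv1 : ∀ b, v b ≤ 1)
    (hvthr : ∀ b, v b ≤ η ∨ 1 - η ≤ v b) :
    (#{a | 1 - η ≤ u a} : ℝ) / Fintype.card α - (#{b | 1 - η ≤ v b} : ℝ) / Fintype.card β - 2 * η ≤
      (∑ a, u a) / Fintype.card α - (∑ b, v b) / Fintype.card β := by
  classical
  have hα : (0 : ℝ) < Fintype.card α := by exact_mod_cast Fintype.card_pos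
  have hβ : (0 : ℝ) < Fintype.card β := by exact_mod_cast Fintype.card_pos
  -- the `u`-side: the mean is at least `(1 - η)` times the density of the super-threshold set
  have hU : (1 - η) * #{a | 1 - η ≤ u a} ≤ ∑ a, u a := by
    calc (1 - η) * #{a | 1 - η ≤ u a} = ∑ a ∈ univ.filter (fun a => 1 - η ≤ u a), (1 - η) := by
          rw [sum_const, nsmul_eq_mul, mul_comm]
      _ ≤ ∑ a ∈ univ.filter (fun a => 1 - η ≤ u a), u a :=
          sum_le_sum fun a ha => (mem_filter.1 ha).2
      _ ≤ ∑ a, u a := sum_le_univ_sum_of_nonneg hu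
  -- the `v`-side: the mean is at most the density of the super-threshold set plus `η`
  have hV : ∑ b, v b ≤ #{b | 1 - η ≤ v b} + η * Fintype.card β := by
    rw [← sum_filter_add_sum_filter_not univ (fun b => 1 - η ≤ v b)]
    have h1 : ∑ b ∈ univ.filter (fun b => 1 - η ≤ v b), v b ≤ #{b | 1 - η ≤ v b} := by
      calc ∑ b ∈ univ.filter (fun b => 1 - η ≤ v b), v b
          ≤ ∑ b ∈ univ.filter (fun b => 1 - η ≤ v b), (1 : ℝ) := sum_le_sum fun b _ => hv1 b
        _ = #{b | 1 - η ≤ v b} := by rw [sum_const, nsmul_eq_mul, mul_one]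
    have h2 : ∑ b ∈ univ.filter (fun b => ¬ 1 - η ≤ v b), v b ≤ η * Fintype.card β := by
      calc ∑ b ∈ univ.filter (fun b => ¬ 1 - η ≤ v b), v b
          ≤ ∑ b ∈ univ.filter (fun b => ¬ 1 - η ≤ v b), η :=
            sum_le_sum fun b hb => (hvthr b).resolve_right (mem_filter.1 hb).2
        _ = η * #{b | ¬ 1 - η ≤ v b} := by rw [sum_const, nsmul_eq_mul, mul_comm]
        _ ≤ η * Fintype.card β := by
            gcongr
            exact_mod_cast (card_filter_le _ _).trans (card_univ (α := β)).le
    linarith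
  -- densities are at most `1`
  have hUle : (#{a | 1 - η ≤ u a} : ℝ) ≤ Fintype.card α := by
    exact_mod_cast (card_filter_le _ _).trans (card_univ (α := α)).le
  rw [div_sub_div _ _ hα.ne' hβ.ne', div_sub_div _ _ hα.ne' hβ.ne', sub_le_iff_le_add, div_add' _ _ _ (by positivity),
    div_le_div_iff_of_pos_right (by positivity)]
  have hUα : (1 - η) * #{a | 1 - η ≤ u a} * Fintype.card β ≤ (∑ a, u a) * Fintype.card β :=
    mul_le_mul_of_nonneg_right hU hβ.le
  have hVβ : (∑ b, v b) * Fintype.card α ≤ (#{b | 1 - η ≤ v b} + η * Fintype.card β) * Fintype.card α :=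
    mul_le_mul_of_nonneg_right hV hα.le
  have hην : η * #{a | 1 - η ≤ u a} ≤ η * Fintype.card α := mul_le_mul_of_nonneg_left hUle hη
  nlinarith [hUα, hVβ, hην, hα, hβ]

/-! ### Hardness of a generator against quantum circuits -/

section QHard

variable {k m : ℕ}

/-- The **distinguishing advantage of a quantum circuit** `C` (oracle-free in the intended use; on
`m` input wires and `a` ancillas, classical input `|y⟩|0ᵃ⟩`, acceptance read on wire `0`) against
a generator `g : {0,1}ᵏ → {0,1}ᵐ`:
`|E_{s ∈ {0,1}ᵏ} Pr[C accepts g(s)] - E_{y ∈ {0,1}ᵐ} Pr[C accepts y]|` (Arunachalam–Grilo–Gur–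
Oliveira–Sundaram 2021, §2.6: "`(s, ε)`-pseudorandom against quantum circuits … each probability
refers to an appropriate random input and the randomness present in the output of `C`"; the
quantum analogue of `Literature.Computability.MetaComplexity.prgAdvantage`).
[cite: ArunachalamGriloGurOliveiraSundaram2021, §2.6 (pseudorandomness against quantum circuits)] -/
def quantumPrgAdvantage {a : ℕ} (C : QCircuit cliffordT (m + a)) (g : (Fin k → Bool) → (Fin m → Bool)) : ℝ :=
  |(∑ s : Fin k → Bool, C.acceptProb 0 (g s)) / 2 ^ k - (∑ y : Fin m → Bool, C.acceptProb 0 y) / 2 ^ m|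

/-- The **hardness of a generator against quantum circuits** `H_q(g) ∈ ℕ ∪ {∞}`: the least `S ≥ 1`
such that some oracle-free Clifford+`T` circuit with at most `S` gates (any number of ancillas)
has distinguishing advantage `≥ 1/S` against `g` — Razborov–Rudich's `H(G)` (tree
`Literature.Computability.MetaComplexity.prgHardness`) with quantum circuits fed the string as
classical input in place of `B₂`-circuits (Arunachalam et al. 2021, §2.6, "for every quantum circuit
`C` of size `s` defined over `m` input bits").
[cite: ArunachalamGriloGurOliveiraSundaram2021, §2.6] [cite: RazborovRudich1997, §4 (definition of H(G))] -/
def quantumPrgHardness (g : (Fin k → Bool) → (Fin m → Bool)) : ℕ∞ :=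
  ⨅ (S : ℕ) (_ : 0 < S)
    (_ : ∃ (a : ℕ) (C : QCircuit cliffordT (m + a)), C.IsOracleFree ∧ C.size ≤ S ∧
      (1 : ℝ) / S ≤ quantumPrgAdvantage C g),
    (S : ℕ∞)

/-- The quantum distinguishing advantage is nonnegative. [folklore] -/
theorem quantumPrgAdvantage_nonneg {a : ℕ} (C : QCircuit cliffordT (m + a)) (g : (Fin k → Bool) → (Fin m → Bool)) :
    0 ≤ quantumPrgAdvantage C g :=
  abs_nonneg _

/-- The quantum distinguishing advantage is at most `1` (acceptance probabilities lie in `[0,1]`,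
`QCircuit.acceptProb_le_one_holds`). [folklore] -/
theorem quantumPrgAdvantage_le_one {a : ℕ} (C : QCircuit cliffordT (m + a)) (g : (Fin k → Bool) → (Fin m → Bool)) :
    quantumPrgAdvantage C g ≤ 1 := by
  unfold quantumPrgAdvantage
  have h0 : ∀ y : Fin m → Bool, 0 ≤ C.acceptProb 0 y := fun y => QCircuit.acceptProb_nonneg _ _ _
  have h1 : ∀ y : Fin m → Bool, C.acceptProb 0 y ≤ 1 := fun y =>
    QCircuit.acceptProb_le_one_holds cliffordT_isUnitary_holds _ _ _
  have hk : (∑ s : Fin k → Bool, C.acceptProb 0 (g s)) / 2 ^ k ≤ 1 := by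
    rw [div_le_one (by positivity)]
    calc (∑ s : Fin k → Bool, C.acceptProb 0 (g s)) ≤ ∑ _s : Fin k → Bool, (1 : ℝ) :=
          sum_le_sum fun s _ => h1 _
      _ = 2 ^ k := by simp
  have hk0 : 0 ≤ (∑ s : Fin k → Bool, C.acceptProb 0 (g s)) / 2 ^ k := by
    have := sum_nonneg fun (s : Fin k → Bool) (_ : s ∈ univ) => h0 (g s)
    positivity
  have hm : (∑ y : Fin m → Bool, C.acceptProb 0 y) / 2 ^ m ≤ 1 := by
    rw [div_le_one (by positivity)]
    calc (∑ y : Fin m → Bool, C.acceptProb 0 y) ≤ ∑ _y : Fin m → Bool, (1 : ℝ) :=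
          sum_le_sum fun y _ => h1 _
      _ = 2 ^ m := by simp
  have hm0 : 0 ≤ (∑ y : Fin m → Bool, C.acceptProb 0 y) / 2 ^ m := by
    have := sum_nonneg fun (y : Fin m → Bool) (_ : y ∈ univ) => h0 y
    positivity
  rw [abs_sub_le_iff]
  constructor <;> linarith

/-- A size `S > 0` witnessed by a quantum distinguisher bounds the quantum hardness from above
(definition as an infimum). [cite: RazborovRudich1997, §4] -/
theorem quantumPrgHardness_le {g : (Fin k → Bool) → (Fin m → Bool)} {S : ℕ} (hS : 0 < S) {a : ℕ}
    (C : QCircuit cliffordT (m + a)) (hC : C.IsOracleFree) (hsize : C.size ≤ S)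
    (hadv : (1 : ℝ) / S ≤ quantumPrgAdvantage C g) : quantumPrgHardness g ≤ S :=
  iInf₂_le_of_le S hS (iInf_le_of_le ⟨a, C, hC, hsize, hadv⟩ le_rfl)

end QHard


/-! ### Padded inputs -/

/-- Input wires of `|x⟩|0^m⟩` hold `x`. [folklore] -/
theorem padInput_apply_of_lt' {n : ℕ} (x : QReg n) (m : ℕ) (i : Fin (n + m)) (hi : (i : ℕ) < n) :
    padInput x m i = x ⟨i, hi⟩ := by
  have : ∃ j : Fin n, i = Fin.castAdd m j := ⟨⟨i, hi⟩, Fin.ext rfl⟩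
  obtain ⟨j, rfl⟩ := this
  rw [padInput, Fin.append_left]
  rfl

/-- Ancilla wires of `|x⟩|0^m⟩` hold `0`. [folklore] -/
theorem padInput_apply_of_le' {n : ℕ} (x : QReg n) (m : ℕ) (i : Fin (n + m)) (hi : n ≤ (i : ℕ)) :
    padInput x m i = false := by
  have : ∃ j : Fin m, i = Fin.natAdd n j := ⟨⟨i - n, by omega⟩, Fin.ext (by simp; omega)⟩
  obtain ⟨j, rfl⟩ := this
  rw [padInput, Fin.append_right]

/-! ### The quantum distinguisher: reversible preprocessing followed by a quantum test -/

namespace QDist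

/-- The data of the distinguisher circuit (a hypothesis structure): the number `Min` of input
wires (the challenge), a quantum test `Tq` on `M + aT` wires (`M` classical input wires, `aT`
ancillas), and a `B₂` straight-line program `gs` with output wires `out` realizing the classical
preprocessing `F : {0,1}^{Min} → {0,1}^M`. [folklore] -/
structure Params where
  /-- number of input wires (length of the challenge) -/
  Min : ℕ
  /-- number of classical input wires of the test (truth-table length) -/
  M : ℕ
  /-- number of ancillas of the test -/
  aT : ℕ
  /-- the quantum test -/
  Tq : QCircuit cliffordT (M + aT)
  /-- the straight-line program of the classical preprocessing -/
  gs : List (Gate (Fin Min))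
  /-- its output wires -/
  out : Fin M → Fin Min ⊕ ℕ
  /-- the preprocessing map -/
  F : (Fin Min → Bool) → (Fin M → Bool)
  /-- the program realizes the map -/
  real : Realizes B2 gs out F
  /-- there is an input wire -/
  hMin : 0 < Min
  /-- there is a test input wire -/
  hM : 0 < M

namespace Params

variable (P : Params)

/-- Width of the front block carrying the test. [folklore] -/
abbrev Mb : ℕ := P.M + P.aT

/-- Start of the zone holding the relocated input (past the block and past the input). [folklore] -/
abbrev base : ℕ := max P.Mb P.Min

/-- Number of gates of the preprocessing program. [folklore] -/
abbrev L : ℕ := P.gs.length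

/-- Number of ancillas of the distinguisher. [folklore] -/
abbrev aD : ℕ := P.base + P.L

/-- Total number of wires of the distinguisher. [folklore] -/
abbrev W : ℕ := P.Min + P.aD

/-- `W = base + Min + L`. [folklore] -/
theorem W_eq : P.W = P.base + P.Min + P.L := by unfold W aD; omega

/-- The block ends before the relocated input. [folklore] -/
theorem Mb_le_base : P.Mb ≤ P.base := le_max_left _ _

/-- The input ends before the relocated input. [folklore] -/
theorem Min_le_base : P.Min ≤ P.base := le_max_right _ _

/-- The block fits into the register. [folklore] -/
theorem Mb_le_W : P.Mb ≤ P.W := by have := P.Mb_le_base; unfold W aD; omega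

/-- The register is nonempty. [folklore] -/
theorem W_pos : 0 < P.W := by have := P.hMin; unfold W; omega

/-- The block is nonempty. [folklore] -/
theorem Mb_pos : 0 < P.Mb := by have := P.hM; unfold Mb; omega

/-- The original input wire `j < Min`. [folklore] -/
def origW (j : Fin P.Min) : Fin P.W := ⟨j, by have := j.isLt; unfold W; omega⟩

/-- The relocated input wire `base + j`. [folklore] -/
def zW (j : Fin P.Min) : Fin P.W := ⟨P.base + j, by have := j.isLt; unfold W aD; omega⟩

/-- The wire of gate `m`: `base + Min + m` (junk `0` for `m ≥ L`). [folklore] -/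
def gW (m : ℕ) : Fin P.W :=
  ⟨if m < P.L then P.base + P.Min + m else 0, by
    have := P.W_pos; split_ifs <;> [(rw [W_eq]; omega); exact this]⟩

/-- The block wire `t < Mb`. [folklore] -/
def blkW (t : Fin P.Mb) : Fin P.W := Fin.castLE P.Mb_le_W t

/-- The naming of the wires of the preprocessing program: inputs on the relocated input wires,
gate `m` on `gW m`. [folklore] -/
def nm : RevB2.Naming (Fin P.Min) (Fin P.W) := ⟨P.zW, P.gW⟩

/-- Position of the original input wire `j`. [folklore] -/
@[simp] theorem origW_val (j : Fin P.Min) : (P.origW j : ℕ) = j := rfl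

/-- Position of the relocated input wire `j`. [folklore] -/
@[simp] theorem zW_val (j : Fin P.Min) : (P.zW j : ℕ) = P.base + j := rfl

/-- Position of the wire of gate `m < L`. [folklore] -/
theorem gW_val_of_lt {m : ℕ} (hm : m < P.L) : (P.gW m : ℕ) = P.base + P.Min + m := by
  change (if m < P.L then P.base + P.Min + m else 0) = _
  rw [if_pos hm]

/-- Position of the block wire `t`. [folklore] -/
@[simp] theorem blkW_val (t : Fin P.Mb) : (P.blkW t : ℕ) = t := rfl

/-- The naming puts the inputs on the relocated input wires. [folklore] -/
@[simp] theorem nm_inW : P.nm.inW = P.zW := rfl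

/-- The naming puts gate `m` on `gW m`. [folklore] -/
@[simp] theorem nm_gW : P.nm.gW = P.gW := rfl

/-! #### Stage A: moving the input out of the block -/

/-- Move of input wire `j` to the fresh wire `zW j`: copy, then clear. [cite: NielsenChuang2010, §1.3.4] -/
def moveOps (j : Fin P.Min) : List (ClOp (Fin P.W)) :=
  [ClOp.cnot (P.origW j) (P.zW j), ClOp.cnot (P.zW j) (P.origW j)]

/-- Stage A: move every input wire. [folklore] -/
def stageA : List (ClOp (Fin P.W)) := (List.finRange P.Min).flatMap P.moveOps

/-- Original and relocated input wires are distinct. [folklore] -/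
theorem origW_ne_zW (j j' : Fin P.Min) : P.origW j ≠ P.zW j' := fun e => by
  have h := congrArg Fin.val e
  rw [origW_val, zW_val] at h
  have := P.Min_le_base
  have := j.isLt
  omega

/-- Relocated input wires are pairwise distinct. [folklore] -/
theorem zW_injective : Injective P.zW := fun j j' e => by
  have h := congrArg Fin.val e
  rw [zW_val, zW_val] at h
  exact Fin.ext (by omega)

/-- Original input wires are pairwise distinct. [folklore] -/
theorem origW_injective : Injective P.origW := fun j j' e => by
  have h := congrArg Fin.val e
  rw [origW_val, origW_val] at h
  exact Fin.ext h

/-- Semantics of one move on an assignment whose destination wire is `0`. [folklore] -/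
theorem clEval_moveOps (j : Fin P.Min) (w : Fin P.W → Bool) (h0 : w (P.zW j) = false) :
    clEval (P.moveOps j) w = update (update w (P.zW j) (w (P.origW j))) (P.origW j) false := by
  have hne := P.origW_ne_zW j j
  funext c
  simp only [moveOps, clEval_cons, clEval_nil, ClOp.eval_cnot]
  by_cases hc : c = P.origW j
  · subst hc
    rw [update_self, update_self, update_of_ne hne, update_self, h0]
    cases w (P.origW j) <;> rfl
  · rw [update_of_ne hc, update_of_ne hc]
    by_cases hc' : c = P.zW j
    · subst hc'
      rw [update_self, update_self, h0]
      cases w (P.origW j) <;> rfl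
    · rw [update_of_ne hc', update_of_ne hc']

/-- **Semantics of stage A** on a list of pairwise distinct input wires whose destinations are
`0`: afterwards the listed input wires are `0`, their destinations carry the old input bits, and
nothing else changed. [folklore] -/
theorem clEval_moves (l : List (Fin P.Min)) (hl : l.Nodup) (w : Fin P.W → Bool)
    (h0 : ∀ j ∈ l, w (P.zW j) = false) :
    (∀ j ∈ l, clEval (l.flatMap P.moveOps) w (P.origW j) = false) ∧
    (∀ j ∈ l, clEval (l.flatMap P.moveOps) w (P.zW j) = w (P.origW j)) ∧
    (∀ c, (∀ j ∈ l, c ≠ P.origW j) → (∀ j ∈ l, c ≠ P.zW j) → clEval (l.flatMap P.moveOps) w c = w c) := by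
  induction l generalizing w with
  | nil => simp
  | cons j l ih =>
    rw [List.nodup_cons] at hl
    obtain ⟨hjl, hl'⟩ := hl
    rw [List.flatMap_cons, clEval_append, P.clEval_moveOps j w (h0 j (by simp))]
    set w₁ := update (update w (P.zW j) (w (P.origW j))) (P.origW j) false with hw₁
    have hz1 : ∀ j' ∈ l, w₁ (P.zW j') = false := fun j' hj' => by
      have hne : j' ≠ j := fun e => hjl (e ▸ hj')
      rw [hw₁, update_of_ne (P.origW_ne_zW j j').symm, update_of_ne (P.zW_injective.ne hne)]
      exact h0 j' (by simp [hj'])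
    obtain ⟨h1, h2, h3⟩ := ih hl' w₁ hz1
    refine ⟨fun j' hj' => ?_, fun j' hj' => ?_, fun c hc1 hc2 => ?_⟩
    · rcases List.mem_cons.1 hj' with rfl | hj'
      · rw [h3 _ (fun j'' hj'' e => hjl (by rw [P.origW_injective e]; exact hj'')) (fun j'' _ => P.origW_ne_zW _ _),
          hw₁, update_self]
      · exact h1 j' hj'
    · rcases List.mem_cons.1 hj' with rfl | hj'
      · rw [h3 _ (fun j'' _ e => P.origW_ne_zW j'' _ e.symm)
          (fun j'' hj'' e => hjl (by rw [P.zW_injective e]; exact hj'')),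
          hw₁, update_of_ne (P.origW_ne_zW _ _).symm, update_self]
      · have hne : j' ≠ j := fun e => hjl (e ▸ hj')
        rw [h2 j' hj', hw₁, update_of_ne (P.origW_injective.ne hne), update_of_ne (P.origW_ne_zW _ _)]
    · rw [h3 c (fun j' hj' => hc1 j' (by simp [hj'])) (fun j' hj' => hc2 j' (by simp [hj'])), hw₁,
        update_of_ne (hc1 j (by simp)), update_of_ne (hc2 j (by simp))]

/-! #### Stage C: copying the outputs into the block -/

/-- The block wire receiving output `t`. [folklore] -/
def outW (t : Fin P.M) : Fin P.W := P.blkW ⟨t, by have := t.isLt; unfold Mb; omega⟩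

/-- Position of the block wire receiving output `t`. [folklore] -/
@[simp] theorem outW_val (t : Fin P.M) : (P.outW t : ℕ) = t := rfl

/-- Stage C: `CNOT` from the wire carrying output `t` of the program onto block wire `t`. [folklore] -/
def stageC : List (ClOp (Fin P.W)) := (List.finRange P.M).map fun t => ClOp.cnot (P.nm.wire (P.out t)) (P.outW t)

/-- The wires read by stage C lie at positions `≥ base`. [folklore] -/
theorem base_le_wire_out (t : Fin P.M) : P.base ≤ (P.nm.wire (P.out t) : ℕ) := by
  cases ht : P.out t with
  | inl i => rw [RevB2.Naming.wire_inl, nm_inW, zW_val]; omega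
  | inr m =>
    have hm : m < P.L := P.real.outOK t m ht
    rw [RevB2.Naming.wire_inr, nm_gW, P.gW_val_of_lt hm]; omega

/-- Output block wires are pairwise distinct. [folklore] -/
theorem outW_injective : Injective P.outW := fun t t' e => by
  have h := congrArg Fin.val e
  rw [outW_val, outW_val] at h
  exact Fin.ext h

/-- **Semantics of stage C**: block wire `t < M` gets XORed with the value of the wire carrying
output `t`; nothing else changes. [cite: AroraBarakCC2009, §10.3.7 (Lemma 10.10: copying the output)] -/
theorem clEval_stageC (w : Fin P.W → Bool) :
    (∀ t, clEval P.stageC w (P.outW t) = xor (w (P.outW t)) (w (P.nm.wire (P.out t)))) ∧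
    (∀ c, (∀ t, c ≠ P.outW t) → clEval P.stageC w c = w c) := by
  have hsrc : ∀ t t' : Fin P.M, P.outW t ≠ P.nm.wire (P.out t') := fun t t' e => by
    have h1 := P.base_le_wire_out t'
    have h2 : (P.outW t : ℕ) < P.base := by
      have := P.Mb_le_base; have := t.isLt; simp [Mb] at *; omega
    rw [← e] at h1
    omega
  have hdisj : ∀ op ∈ P.stageC, ∀ op' ∈ P.stageC, op'.target ∉ op.controls := by
    intro op hop op' hop'
    simp only [stageC, List.mem_map, List.mem_finRange, true_and] at hop hop'
    obtain ⟨t, rfl⟩ := hop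
    obtain ⟨t', rfl⟩ := hop'
    simp [ClOp.target, ClOp.controls, hsrc]
  have hnd : (P.stageC.map ClOp.target).Nodup := by
    simp only [stageC, List.map_map]
    exact (List.nodup_finRange P.M).map (fun t t' e => P.outW_injective e)
  refine ⟨fun t => ?_, fun c hc => ?_⟩
  · have hop : ClOp.cnot (P.nm.wire (P.out t)) (P.outW t) ∈ P.stageC := by
      simp only [stageC, List.mem_map, List.mem_finRange, true_and]; exact ⟨t, rfl⟩
    have := clEval_apply_target_of_nodup P.stageC hdisj hnd w hop
    simpa [ClOp.target, ClOp.guard] using this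
  · refine clEval_apply_of_forall_target_ne _ _ fun op hop => ?_
    simp only [stageC, List.mem_map, List.mem_finRange, true_and] at hop
    obtain ⟨t, rfl⟩ := hop
    exact fun e => hc t e.symm

/-! #### The whole classical stage -/

/-- The classical stage: move the input, compute the gates, copy the outputs. [folklore] -/
def prog : List (ClOp (Fin P.W)) := P.stageA ++ (RevB2.compile P.nm P.gs ++ P.stageC)

/-- Gate wires are pairwise distinct. [folklore] -/
theorem gW_injOn : ∀ m < P.L, ∀ m' < P.L, P.gW m = P.gW m' → m = m' := fun m hm m' hm' e => by
  have := congrArg Fin.val e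
  rw [P.gW_val_of_lt hm, P.gW_val_of_lt hm'] at this
  omega

/-- Relocated input wires and gate wires are distinct. [folklore] -/
theorem zW_ne_gW (i : Fin P.Min) : ∀ m < P.L, P.zW i ≠ P.gW m := fun m hm e => by
  have := congrArg Fin.val e
  rw [zW_val, P.gW_val_of_lt hm] at this
  have := i.isLt
  omega

/-- All operations of the classical stage are well formed. [folklore] -/
theorem prog_wf : ∀ op ∈ P.prog, op.WF := by
  intro op hop
  simp only [prog, List.mem_append] at hop
  rcases hop with hop | hop | hop
  · simp only [stageA, List.mem_flatMap, List.mem_finRange, true_and, moveOps] at hop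
    obtain ⟨j, hj⟩ := hop
    simp only [List.mem_cons, List.not_mem_nil, or_false] at hj
    rcases hj with rfl | rfl
    · exact P.origW_ne_zW j j
    · exact (P.origW_ne_zW j j).symm
  · exact RevB2.wf_compile P.nm P.gs P.real.wf P.gW_injOn P.zW_ne_gW op hop
  · simp only [stageC, List.mem_map, List.mem_finRange, true_and] at hop
    obtain ⟨t, rfl⟩ := hop
    intro e
    have h1 := P.base_le_wire_out t
    have h2 : (P.outW t : ℕ) < P.base := by
      have := P.Mb_le_base; have := t.isLt; simp [Mb] at *; omega
    rw [e] at h1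
    omega

/-- **Semantics of the classical stage on the padded input `|z⟩|0…0⟩`, read on the block**: the
first `M` block wires carry `F z`, the remaining `aT` block wires are still `0`, i.e. the block
carries the padded test input `|F z⟩|0^{aT}⟩`. [cite: AroraBarakCC2009, §10.3.7 (Lemma 10.10)] -/
theorem clEval_prog_comp_castLE (z : Fin P.Min → Bool) :
    clEval P.prog (padInput z P.aD) ∘ Fin.castLE P.Mb_le_W = padInput (P.F z) P.aT := by
  -- stage A
  set w₀ : Fin P.W → Bool := padInput z P.aD with hw₀
  have hw₀lt : ∀ c : Fin P.W, (hc : (c : ℕ) < P.Min) → w₀ c = z ⟨c, hc⟩ := fun c hc => by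
    rw [hw₀]; exact padInput_apply_of_lt' z P.aD c hc
  have hw₀ge : ∀ c : Fin P.W, P.Min ≤ (c : ℕ) → w₀ c = false := fun c hc => by
    rw [hw₀]; exact padInput_apply_of_le' z P.aD c hc
  obtain ⟨hA1, hA2, hA3⟩ := P.clEval_moves (List.finRange P.Min) (List.nodup_finRange _) w₀
    (fun j _ => hw₀ge _ (by simp; have := P.Min_le_base; omega))
  set wA := clEval P.stageA w₀ with hwA
  have hwA_def : clEval ((List.finRange P.Min).flatMap P.moveOps) w₀ = wA := rfl
  rw [hwA_def] at hA1 hA2 hA3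
  simp only [List.mem_finRange, forall_const] at hA1 hA2 hA3
  -- stage B
  have hinB : ∀ i, wA (P.nm.inW i) = z i := fun i => by
    rw [nm_inW, hA2 i, hw₀lt _ (by simp)]
    exact congrArg z (Fin.ext rfl)
  have hzB : ∀ m < P.gs.length, wA (P.nm.gW m) = false := fun m hm => by
    have hm' : m < P.L := hm
    rw [nm_gW, hA3 (P.gW m) (fun j e => absurd (congrArg Fin.val e) (by rw [P.gW_val_of_lt hm', origW_val]; omega))
      (fun j e => P.zW_ne_gW j m hm' e.symm)]
    exact hw₀ge _ (by rw [P.gW_val_of_lt hm']; omega)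
  obtain ⟨hB1, hB2, hB3⟩ := RevB2.clEval_compile P.nm z P.gs P.real.wf P.real.isOver
    P.gW_injOn P.zW_ne_gW wA hinB hzB
  set wB := clEval (RevB2.compile P.nm P.gs) wA with hwB
  -- the wires read by stage C carry `F z`
  have hsrc : ∀ t, wB (P.nm.wire (P.out t)) = P.F z t := fun t => by
    rw [← P.real.eval z t]
    cases ht : P.out t with
    | inl i => rw [RevB2.Naming.wire_inl, hB1 i, wireOf_inl]
    | inr m => rw [RevB2.Naming.wire_inr, hB2 m (P.real.outOK t m ht), wireOf_inr]
  -- the block wires are still `0` after stage B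
  have hblk : ∀ c : Fin P.W, (c : ℕ) < P.Mb → wB c = false := fun c hc => by
    have hcb : (c : ℕ) < P.base := lt_of_lt_of_le hc P.Mb_le_base
    rw [hB3 c (fun i e => absurd (congrArg Fin.val e) (by rw [nm_inW, zW_val]; omega))
      (fun m hm e => absurd (congrArg Fin.val e) (by rw [nm_gW, P.gW_val_of_lt hm]; omega))]
    rcases Nat.lt_or_ge (c : ℕ) P.Min with hcm | hcm
    · exact hA1 ⟨c, hcm⟩
    · rw [hA3 c (fun j e => absurd (congrArg Fin.val e) (by rw [origW_val]; omega))
        (fun j e => absurd (congrArg Fin.val e) (by rw [zW_val]; omega))]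
      exact hw₀ge c hcm
  -- stage C
  obtain ⟨hC1, hC2⟩ := P.clEval_stageC wB
  have hprog : clEval P.prog w₀ = clEval P.stageC wB := by
    rw [prog, clEval_append, clEval_append]
  funext u
  rw [Function.comp_apply, hprog]
  rcases Nat.lt_or_ge (u : ℕ) P.M with hu | hu
  · have hcast : Fin.castLE P.Mb_le_W u = P.outW ⟨u, hu⟩ := Fin.ext rfl
    rw [hcast, hC1, hsrc, hblk _ (by change (u : ℕ) < P.M + P.aT; omega), Bool.false_xor]
    unfold Mb at u
    rw [padInput_apply_of_lt' _ _ u hu]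
  · rw [hC2 _ (fun t e => absurd (congrArg Fin.val e) (by rw [outW_val, Fin.val_castLE]; omega)),
      hblk _ u.isLt]
    unfold Mb at u
    rw [padInput_apply_of_le' _ _ u hu]

/-- A `flatMap` all of whose chunks have length `n` has length `|l| · n`. [folklore] -/
theorem length_flatMap_of_forall_eq {α β : Type*} (l : List α) (f : α → List β) (n : ℕ)
    (h : ∀ a ∈ l, (f a).length = n) : (l.flatMap f).length = l.length * n := by
  induction l with
  | nil => simp
  | cons a l ih =>
    rw [List.flatMap_cons, List.length_append, h a (by simp), ih (fun a' ha' => h a' (by simp [ha'])),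
      List.length_cons, Nat.succ_mul, Nat.add_comm]

/-- Length of the classical stage: `2·Min + 4·L + M` operations at most. [folklore] -/
theorem length_prog_le : P.prog.length ≤ 2 * P.Min + 4 * P.L + P.M := by
  have hA : P.stageA.length = P.Min * 2 := by
    rw [stageA, length_flatMap_of_forall_eq _ _ 2 (fun j _ => rfl), List.length_finRange]
  have hB := RevB2.length_compile_le P.nm P.gs
  have hC : P.stageC.length = P.M := by simp [stageC]
  simp only [prog, List.length_append, hA, hC]
  unfold L
  omega

/-! #### The quantum circuit -/

/-- **The distinguisher circuit**: the compiled classical stage followed by the test placed on the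
front block `[0, M + aT)`. [cite: AroraBarakCC2009, §10.3.7 (Lemma 10.10)] [cite: NielsenChuang2010, §4.3] -/
def circuit : QCircuit cliffordT (P.Min + P.aD) :=
  (⟨revCompile (toRevList P.prog P.prog_wf)⟩ : QCircuit cliffordT P.W).append
    (mapWires (Fin.castLEEmb P.Mb_le_W) P.Tq)

/-- The distinguisher is oracle-free if the test is. [folklore] -/
theorem circuit_isOracleFree (hT : P.Tq.IsOracleFree) : P.circuit.IsOracleFree := by
  intro g hg
  rw [circuit, QCircuit.gates_append, List.mem_append] at hg
  rcases hg with hg | hg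
  · exact revCompile_isOracleFree _ g hg
  · exact isOracleFree_mapWires _ hT g hg

/-- **Size of the distinguisher**: `24·(2·Min + 4·L + M) + |Tq|` gates at most. [folklore] -/
theorem size_circuit_le : P.circuit.size ≤ 24 * (2 * P.Min + 4 * P.L + P.M) + P.Tq.size := by
  have h1 := length_revCompile_le (toRevList P.prog P.prog_wf)
  rw [length_toRevList] at h1
  have h2 := P.length_prog_le
  have h3 : P.circuit.size = (revCompile (toRevList P.prog P.prog_wf)).length + P.Tq.size := by
    rw [circuit, QCircuit.size_append, size_mapWires]; rfl
  rw [h3]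
  omega

/-- **The distinguisher accepts `z` exactly with the probability that the test accepts `F z`.**
The classical stage maps `|z⟩|0…0⟩` to a basis state whose front block reads `|F z⟩|0^{aT}⟩`
(`clEval_prog_comp_castLE`, `revCompile_mulVec_basisState`), the test acts on that block, and the
statistics of wire `0` of the block are those of the test on `|F z⟩|0^{aT}⟩`
(`sum_normSq_placeGate_castLE`). [cite: NielsenChuang2010, §2.2.8 and §4.3] -/
theorem acceptProb_circuit (z : Fin P.Min → Bool) : P.circuit.acceptProb 0 z = P.Tq.acceptProb 0 (P.F z) := by
  have hW : 0 < P.Min + P.aD := P.W_pos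
  have hMb : 0 < P.M + P.aT := P.Mb_pos
  set wC : Fin P.W → Bool := clEval P.prog (padInput z P.aD) with hwC
  have hrun : P.circuit.runOn 0 (basisState (padInput z P.aD)) =
      placeGate (Fin.castLEEmb P.Mb_le_W) (P.Tq.toMatrix 0) *ᵥ basisState wC := by
    rw [QCircuit.runOn, circuit, QCircuit.toMatrix_append, ← Matrix.mulVec_mulVec, revCompile_mulVec_basisState,
      revEval_toRevList, toMatrix_mapWires]
  have hblock : wC ∘ Fin.castLEEmb P.Mb_le_W = padInput (P.F z) P.aT := by
    rw [Fin.coe_castLEEmb]; exact P.clEval_prog_comp_castLE z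
  unfold QCircuit.acceptProb
  simp only [hW, hMb, dif_pos]
  rw [hrun]
  have h0 : ∀ y : QReg (P.Min + P.aD), y ⟨0, hW⟩ = (y ∘ Fin.castLEEmb P.Mb_le_W) ⟨0, hMb⟩ := fun y => rfl
  simp only [h0]
  rw [sum_normSq_placeGate_castLE P.Mb_le_W (P.Tq.toMatrix 0) wC (fun u => u ⟨0, hMb⟩ = true), hblock]
  refine Finset.sum_congr rfl fun u _ => ?_
  rw [QCircuit.runOn, mulVec_basisState]

end Params

end QDist

/-! ### The finite core: a quantum test on truth tables bounds the quantum hardness of the generator -/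

section Core

/-- **Razborov–Rudich's hybrid argument with a quantum test (finite core).** Let
`G₂ : {0,1}ᵏ⁺¹ → {0,1}^{2(k+1)}` have `B₂`-circuits of size `≤ sb` per output bit, and let `Tq` be
an oracle-free Clifford+`T` circuit on `2^{m+1}` classical input wires (a test on truth tables of
`(m+1)`-variable Boolean functions, fed the truth table as a basis state) and `aT` ancillas whose
acceptance probabilities have the two-sided threshold property with margin `η < 1/2` (every truth
table is accepted with probability `≤ η` or `≥ 1 - η`), which accepts the truth table of every
Goldreich–Goldwasser–Micali function `y ↦ bit₀ (G_y(x))` with probability `≤ η`, and which accepts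
at least `B · 2^{2^{m+1}}` truth tables with probability `≥ 1 - η`. Then `H_q(G₂) ≤ S` for every
`S` exceeding the size `24·(4(k+1) + 4·((k+1) + 2^{m+2}(k+1)(sb+1)) + 2^{m+1}) + |Tq|` of the
distinguisher with `1/S ≤ B/(2^{m+1} - 1) - 2η`: the hybrid argument over the GGM tree
(`Literature.Computability.MetaComplexity.exists_distinguisher`, applied to the Boolean test
"accepted with probability `≥ 1 - η`") provides a node and a fixing of the fresh labels at which
the thresholded test tells a uniform challenge from a pseudo-random one with advantage
`≥ B/(2^{m+1} - 1)`; the quantum circuit "compute the truth table of the distinguisher tree from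
the challenge reversibly, then run `Tq` on it" (`QDist.Params.circuit`,
`QDist.Params.acceptProb_circuit`) has expected acceptance gap at least that advantage minus `2η`
(`expectation_gap_of_threshold`). This is the proof of Razborov–Rudich 1997, Thm. 4.1 with the
`B₂`-circuit test replaced by a quantum circuit reading the truth table as classical input — the
reduction in print for `MQCSP ∈ BQP` (Chia–Chou–Zhang–Zhang 2022, Lemma 4.6 and Thm. 4.7/§4.1.2,
"Algorithm 1: a quantum algorithm for breaking qPRG": given `T(h)`, run the quantum algorithm for
the property). [cite: RazborovRudich1997, Thm. 4.1 (proof)] [cite: ChiaChouZhangZhang2022, §4.1.1 Lemma 4.6 and §4.1.2] -/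
theorem quantumPrgHardness_le_of_qtest {k m sb aT : ℕ}
    (G₂ : (Fin (k + 1) → Bool) → (Fin (2 * (k + 1)) → Bool))
    (hG : ∀ i, CktSize B2 (fun s (_ : Unit) => G₂ s i) sb)
    (Tq : QCircuit cliffordT (2 ^ (m + 1) + aT)) (hTq : Tq.IsOracleFree)
    {η : ℝ} (hη0 : 0 ≤ η) (hη : η < 1 / 2)
    (hthr : ∀ w : Fin (2 ^ (m + 1)) → Bool, Tq.acceptProb 0 w ≤ η ∨ 1 - η ≤ Tq.acceptProb 0 w)
    (hU : ∀ x : Fin (k + 1) → Bool,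
      Tq.acceptProb 0 (fun t => ggmLab (halfGen G₂) x (m + 1) ((boolFunEquivFin (m + 1)).symm t) 0) ≤ η)
    {B : ℝ} (hB : B * 2 ^ 2 ^ (m + 1) ≤
      #{h : (Fin (m + 1) → Bool) → Bool | 1 - η ≤ Tq.acceptProb 0 (fun t => h ((boolFunEquivFin (m + 1)).symm t))})
    {S : ℕ} (hS : 24 * (2 * (2 * (k + 1)) + 4 * ((k + 1) + 2 ^ (m + 1 + 1) * (k + 1) * (sb + 1)) + 2 ^ (m + 1)) +
      Tq.size ≤ S)
    (hSB : (1 : ℝ) / S ≤ B / (2 ^ (m + 1) - 1 : ℕ) - 2 * η) :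
    quantumPrgHardness G₂ ≤ S := by
  classical
  -- the hybrid lemma for the thresholded test
  set g := halfGen G₂ with hg_def
  set o : (Fin (k + 1) → Bool) → Bool := fun s => s 0 with ho_def
  set τ : ((Fin (m + 1) → Bool) → Bool) → ℝ :=
    fun h => Tq.acceptProb 0 (fun t => h ((boolFunEquivFin (m + 1)).symm t)) with hτ_def
  set T : ((Fin (m + 1) → Bool) → Bool) → Bool := fun h => decide (1 - η ≤ τ h) with hT_def
  have hA : ∀ x : Fin (k + 1) → Bool, T (fun y => o (ggmLab g x (m + 1) y)) = false := fun x => by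
    simp only [hT_def, decide_eq_false_iff_not, not_le, hτ_def, ho_def]
    exact lt_of_le_of_lt (hU x) (by linarith)
  have hB' : B * 2 ^ 2 ^ (m + 1) ≤ #{h : (Fin (m + 1) → Bool) → Bool | T h = true} := by
    rwa [Finset.filter_congr (fun h _ => by rw [hT_def, decide_eq_true_iff])]
  obtain ⟨i, ω, -, hadv⟩ := exists_distinguisher (g := g) (o := o)
    (flip := fun s => update s 0 (!s 0)) (fun s => by simp [ho_def])
    (fun s => by ext j; by_cases hj : j = 0 <;> simp [hj]) T hA hB'
  -- the classical preprocessing: the truth table of the distinguisher tree as a function of the challenge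
  have hg : ∀ (b : Bool) (j : Fin (k + 1)), CktSize B2 (fun s (_ : Unit) => g b s j) sb :=
    fun b j => hG (halfEquiv (k + 1) (b, j))
  have hF : CktSize B2 (fun (w : Fin (2 * (k + 1)) → Bool) (t : Fin (2 ^ (m + 1))) =>
      distLab g ω.rho ω.1 i (fun b j => w (halfEquiv (k + 1) (b, j))) (m + 1) ((boolFunEquivFin (m + 1)).symm t) 0)
      ((k + 1) + 2 ^ (m + 1 + 1) * (k + 1) * (sb + 1)) := by
    have h := ((cktSize_distLab g ω.rho ω.1 i hg (m + 1)).outMap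
      (fun t : Fin (2 ^ (m + 1)) => Sum.inr ((boolFunEquivFin (m + 1)).symm t, (0 : Fin (k + 1))))).rewire
      (ι' := Fin (2 * (k + 1))) (halfEquiv (k + 1))
    refine (h.of_le ?_).congr fun w t => rfl
    have := distSize_le (k + 1) sb (m + 1)
    omega
  obtain ⟨gs, out, hlen, hreal⟩ := hF
  -- the distinguisher circuit
  let P : QDist.Params := ⟨2 * (k + 1), 2 ^ (m + 1), aT, Tq, gs, out, _, hreal, by omega, by positivity⟩
  have hL : P.L ≤ (k + 1) + 2 ^ (m + 1 + 1) * (k + 1) * (sb + 1) := hlen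
  have hsize : P.circuit.size ≤ S :=
    P.size_circuit_le.trans (le_trans (by change 24 * (2 * (2 * (k + 1)) + 4 * P.L + 2 ^ (m + 1)) + Tq.size ≤ _; omega) hS)
  have hSpos : 0 < S := by
    have : 0 < 24 * (2 * (2 * (k + 1)) + 4 * ((k + 1) + 2 ^ (m + 1 + 1) * (k + 1) * (sb + 1)) + 2 ^ (m + 1)) := by
      positivity
    omega
  refine quantumPrgHardness_le hSpos P.circuit (P.circuit_isOracleFree hTq) hsize (hSB.trans ?_)
  -- its advantage: the acceptance probabilities are those of the test on the truth tables
  have hacc : ∀ w : Fin (2 * (k + 1)) → Bool,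
      P.circuit.acceptProb 0 w = τ (distFun g o ω i (splitEquiv (k + 1) w)) := fun w =>
    P.acceptProb_circuit w
  have hpr : ∀ s : Fin (k + 1) → Bool, splitEquiv (k + 1) (G₂ s) = fun b => g b s := fun s => rfl
  have hcσ : (Fintype.card (Fin (k + 1) → Bool) : ℝ) = 2 ^ (k + 1) := by simp
  have hcB : (Fintype.card (Bool → Fin (k + 1) → Bool) : ℝ) = 2 ^ (2 * (k + 1)) := by
    rw [Fintype.card_fun, Fintype.card_bool, Fintype.card_fun, Fintype.card_bool, Fintype.card_fin]
    push_cast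
    rw [← pow_mul, mul_comm]
  have e1 : (∑ s : Fin (k + 1) → Bool, P.circuit.acceptProb 0 (G₂ s)) / 2 ^ (k + 1) =
      (∑ s : Fin (k + 1) → Bool, τ (distFun g o ω i fun b => g b s)) / Fintype.card (Fin (k + 1) → Bool) := by
    rw [hcσ]
    congr 1
    exact Finset.sum_congr rfl fun s _ => by rw [hacc, hpr]
  have e2 : (∑ y : Fin (2 * (k + 1)) → Bool, P.circuit.acceptProb 0 y) / 2 ^ (2 * (k + 1)) =
      (∑ z : Bool → Fin (k + 1) → Bool, τ (distFun g o ω i z)) / Fintype.card (Bool → Fin (k + 1) → Bool) := by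
    rw [hcB]
    congr 1
    simp only [hacc]
    exact Fintype.sum_equiv (splitEquiv (k + 1)) _ _ fun y => rfl
  -- from the thresholded gap to the expectation gap
  have hgap := expectation_gap_of_threshold (α := Bool → Fin (k + 1) → Bool) (β := Fin (k + 1) → Bool)
    (u := fun z => τ (distFun g o ω i z)) (v := fun s => τ (distFun g o ω i fun b => g b s)) hη0
    (fun z => QCircuit.acceptProb_nonneg _ _ _)
    (fun s => QCircuit.acceptProb_le_one_holds cliffordT_isUnitary_holds _ _ _)
    (fun s => hthr _)
  have hz : #{z : Bool → Fin (k + 1) → Bool | T (distFun g o ω i z) = true} =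
      #{z : Bool → Fin (k + 1) → Bool | 1 - η ≤ τ (distFun g o ω i z)} :=
    congrArg Finset.card (Finset.filter_congr fun z _ => by rw [hT_def, decide_eq_true_iff])
  have hs : #{s : Fin (k + 1) → Bool | T (distFun g o ω i fun b => g b s) = true} =
      #{s : Fin (k + 1) → Bool | 1 - η ≤ τ (distFun g o ω i fun b => g b s)} :=
    congrArg Finset.card (Finset.filter_congr fun s _ => by rw [hT_def, decide_eq_true_iff])
  rw [hz, hs] at hadv
  rw [quantumPrgAdvantage, e1, e2, abs_sub_comm]
  refine le_trans ?_ (le_abs_self _)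
  linarith [hgap, hadv]

end Core

/-! ### The quantum test supplied by a `BQP`-constructive property -/

section QTest

/-- The acceptance probability of a family on the string `List.ofFn w` is that of its circuit for
length `N` on the register content `w`. [folklore] -/
theorem acceptProbOn_ofFn (F : QCircuitFamily cliffordT) {N : ℕ} (w : Fin N → Bool) :
    F.acceptProbOn 0 (List.ofFn w) = (F.circ N).acceptProb 0 w := by
  unfold QCircuitFamily.acceptProbOn
  have key : ∀ (x : List Bool) (h : x.length = N), (F.circ x.length).acceptProb 0 x.get =
      (F.circ N).acceptProb 0 (fun i => x.get (Fin.cast h.symm i)) := by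
    intro x h; subst h; rfl
  rw [key _ (List.length_ofFn ..)]
  congr 1
  funext i
  simp

/-- **A `BQP`-constructive property supplies a quantum test with inverse-polynomial error.** If the
truth-table language of `P'` is in `BQP`, then for every `d` there is an oracle-free Clifford+`T`
circuit family of polynomial size and ancilla count which, fed the truth table of
`f : {0,1}ⁿ → {0,1}` as a basis state, accepts with probability `≥ 1 - 1/(4·2^{dn})` if
`f ∈ P'ₙ` and `≤ 1/(4·2^{dn})` otherwise (error reduction to inverse-polynomial error in the
input length `N = 2ⁿ` by majority vote over polynomially many copies,
`Literature.Computability.QuantumComplexity.PolyCopies.exists_poly_amplified`; polynomial size by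
uniformity). [cite: ArunachalamGriloGurOliveiraSundaram2021, Def. 10 and Def. 12 (§2.4: "𝔇 = BQP … the algorithm is allowed to run in time polynomial in N = 2ⁿ")] [cite: BennettBernsteinBrassardVazirani1997, Thm. 4.13] -/
theorem qtest_of_isConstructive {P' : CombinatorialProperty} (h : IsConstructive BQP P') (d : ℕ) :
    ∃ (q : Polynomial ℕ) (F : QCircuitFamily cliffordT), F.IsOracleFree ∧
      (∀ N, (F.circ N).size ≤ q.eval N ∧ F.ancillas N ≤ q.eval N) ∧
      ∀ (n : ℕ) (f : (Fin n → Bool) → Bool),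
        (f ∈ P' n → 1 - 1 / (4 * (2 : ℝ) ^ (d * n)) ≤
          (F.circ (2 ^ n)).acceptProb 0 (fun t => f ((boolFunEquivFin n).symm t))) ∧
        (f ∉ P' n → (F.circ (2 ^ n)).acceptProb 0 (fun t => f ((boolFunEquivFin n).symm t)) ≤
          1 / (4 * (2 : ℝ) ^ (d * n))) := by
  simp only [IsConstructive, CombinatorialProperty.toLanguage_eq] at h
  obtain ⟨F₀, hF₀free, hF₀U, hF₀⟩ := ClassBQP.mem_BQP_iff.1 h
  obtain ⟨F, hFfree, hFU, hF⟩ := exists_poly_amplified hF₀free hF₀U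
    (Polynomial.C 36 * Polynomial.X ^ d) (η := 1 / 6) (by norm_num)
  obtain ⟨q, hq⟩ := QCircuitFamily.IsUniform.isPolySize' hFU
  refine ⟨q, F, hFfree, hq, fun n f => ?_⟩
  have htt : truthTable f = List.ofFn fun t => f ((boolFunEquivFin n).symm t) := rfl
  have hacc : F.acceptProbOn 0 (truthTable f) = (F.circ (2 ^ n)).acceptProb 0 fun t => f ((boolFunEquivFin n).symm t) := by
    rw [htt, acceptProbOn_ofFn]
  -- the error bound at length `2ⁿ`
  have hlen : (truthTable f).length = 2 ^ n := length_truthTable f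
  have herr : 1 / (4 * ((Polynomial.eval (truthTable f).length (Polynomial.C 36 * Polynomial.X ^ d) + 1 : ℕ) : ℝ) *
      (1 / 6 : ℝ) ^ 2) ≤ 1 / (4 * (2 : ℝ) ^ (d * n)) := by
    rw [hlen]
    have hY : (0 : ℝ) < (2 : ℝ) ^ (d * n) := by positivity
    have hev : ((Polynomial.eval (2 ^ n) (Polynomial.C 36 * Polynomial.X ^ d) + 1 : ℕ) : ℝ) = 36 * 2 ^ (d * n) + 1 := by
      push_cast [Polynomial.eval_mul, Polynomial.eval_C, Polynomial.eval_pow, Polynomial.eval_X]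
      rw [← pow_mul, mul_comm n d]
    rw [hev]
    apply one_div_le_one_div_of_le (by positivity)
    nlinarith
  have hx := hF (truthTable f)
  refine ⟨fun hf => ?_, fun hf => ?_⟩
  · have h23 : 1 / 2 + 1 / 6 ≤ F₀.acceptProbOn 0 (truthTable f) := by
      have := (hF₀ (truthTable f)).1 ((truthTable_mem_truthTableLanguage_iff P' f).2 hf)
      linarith
    have := hx.1 h23
    rw [hacc] at this
    linarith
  · have h13 : F₀.acceptProbOn 0 (truthTable f) ≤ 1 / 2 - 1 / 6 := by
      have := (hF₀ (truthTable f)).2 (fun hmem => hf ((truthTable_mem_truthTableLanguage_iff P' f).1 hmem))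
      linarith
    have := hx.2 h13
    rw [hacc] at this
    exact this.trans herr

open Classical in
/-- The functions of `P'ₙ`, counted inside all `n`-variable Boolean functions, are `|P'ₙ|` many.
[folklore] -/
theorem card_filter_mem_eq (P' : CombinatorialProperty) (n : ℕ) :
    #{h : (Fin n → Bool) → Bool | h ∈ P' n} = Nat.card (P' n) := by
  rw [Nat.card_eq_card_toFinset, ← Set.filter_mem_univ_eq_toFinset]

end QTest

/-! ### The barrier theorem: quantum natural properties versus quantum-hard generators -/

section Barrier

/-- **Natural proofs barrier for quantum-constructive properties, fixed usefulness exponent.**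
For every generator family `G = (Gₖ : {0,1}ᵏ → {0,1}²ᵏ)` computable in `P/poly` and every
`ε > 0` there is an exponent `c` such that: if `Q` is a `BQP`-natural combinatorial property (it
contains a large sub-property whose truth-table language is in `BQP` — a "quantum natural
property", Arunachalam et al. Def. 10 with `𝔇 = BQP`) all of whose members at length `n` have
`B₂`-circuit size `> n^c` for all large `n`, then the QUANTUM hardness `H_q(Gₖ)` drops below
`2^{k^ε}` for all sufficiently large `k`. The proof is Razborov–Rudich's (tree:
`Literature.Computability.Complexity.natural_proofs_barrier_fixedExponent`) with two changes: the
test on truth tables is the property's uniform Clifford+`T` family amplified to error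
`2^{-(c₁+2)n}/4` (`qtest_of_isConstructive`), and the distinguisher is the quantum circuit of
`quantumPrgHardness_le_of_qtest` (classical GGM/hybrid preprocessing compiled to Toffoli gates,
followed by the test); all sizes are `2^{O(n)} < 2^{k^ε}` for `n = ⌊k^{1/D}⌋`, `1/D < ε`.
[cite: RazborovRudich1997, Thm. 4.1] [cite: AroraBarakCC2009, Thm. 23.1 and §23.3 (PDF pp. 587, 591–592)] [cite: ChiaChouZhangZhang2022, §4.1.2 (MQCSP ∈ BQP ⇒ no quantum-secure one-way functions) with Lemma 4.6] [cite: ArunachalamGriloGurOliveiraSundaram2021, Def. 10 and Def. 12 (§2.4)] -/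
theorem quantum_natural_proofs_barrier_fixedExponent (G : PRGFamily) (hG : G.IsInPPoly) {ε : ℝ}
    (hε : 0 < ε) :
    ∃ c : ℕ, ∀ Q : CombinatorialProperty, IsNatural BQP Q →
      IsUsefulAgainstSize (fun n => n ^ c) Q →
        ∀ᶠ k : ℕ in atTop, quantumPrgHardness (G k) < (⌈(2 : ℝ) ^ ((k : ℝ) ^ ε)⌉₊ : ℕ∞) := by
  classical
  obtain ⟨p, hp⟩ := cktSize_of_isInPPoly hG
  -- the root parameter `D` with `1/D < ε`
  obtain ⟨D, hD⟩ := exists_nat_gt (1 / ε)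
  have hDpos : 0 < D := by
    have : (0 : ℝ) < D := lt_trans (by positivity) hD
    exact_mod_cast this
  have hDε : (D : ℝ)⁻¹ < ε := by
    rw [inv_lt_comm₀ (by exact_mod_cast hDpos) hε]
    simpa [one_div] using hD
  -- size bounds as functions of `n` alone (using `k < (n+1)^D`)
  have hpoly : ∀ r : Polynomial ℕ, IsPBounded fun n => r.eval n := fun r =>
    (isPBounded_iff_exists_polynomial_holds _).2 ⟨r, fun _ => le_rfl⟩
  obtain ⟨A, a, hA⟩ := (IsPBounded.iff_exists_le_mul_succ_pow _).1 (hpoly p)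
  have h1 : IsPBounded fun n => n + 1 := IsPBounded.add_holds IsPBounded.id (IsPBounded.const 1)
  have hK : IsPBounded fun n => (n + 1) ^ D := IsPBounded.pow_holds h1 D
  have hsbB : IsPBounded fun n => A * ((n + 1) ^ D + 1) ^ a :=
    IsPBounded.mul_holds (IsPBounded.const A)
      (IsPBounded.pow_holds (IsPBounded.add_holds hK (IsPBounded.const 1)) a)
  have hΦf : IsPBounded fun n =>
      n * (2 * ((n + 1) ^ D * (A * ((n + 1) ^ D + 1) ^ a)) + (n + 1) ^ D * 4) + 2 :=
    IsPBounded.add_holds (IsPBounded.mul_holds IsPBounded.id (IsPBounded.add_holds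
      (IsPBounded.mul_holds (IsPBounded.const 2) (IsPBounded.mul_holds hK hsbB))
      (IsPBounded.mul_holds hK (IsPBounded.const 4)))) (IsPBounded.const 2)
  -- THE fixed exponent: `c₂`, depending on `p` (through `A`, `a`) and on `D` only
  obtain ⟨c₂, hc₂⟩ := hΦf.eventually_lt_pow
  obtain ⟨n₂, hn₂⟩ := eventually_atTop.1 hc₂
  refine ⟨c₂, fun Q hN hU => ?_⟩
  obtain ⟨P', hP'P, hcons, hlarge⟩ := hN
  obtain ⟨c₁, hc₁⟩ := hlarge
  obtain ⟨n₁, hn₁⟩ := eventually_atTop.1 hc₁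
  -- the quantum test, amplified to error `2^{-(c₁+2) n}/4`
  obtain ⟨q, F, hFfree, hq, hF⟩ := qtest_of_isConstructive hcons (c₁ + 2)
  -- the size of the quantum distinguisher, `2^{O(n)}`
  have hΦd : IsExpBounded fun n =>
      24 * (2 * (2 * (n + 1) ^ D) + 4 * ((n + 1) ^ D + 2 ^ (n + 1) * (n + 1) ^ D * (A * ((n + 1) ^ D + 1) ^ a + 1)) +
        2 ^ n) + q.eval (2 ^ n) :=
    ((IsExpBounded.const 24).mul ((((IsExpBounded.const 2).mul ((IsExpBounded.const 2).mul
      (IsExpBounded.of_isPBounded hK))).add ((IsExpBounded.const 4).mul ((IsExpBounded.of_isPBounded hK).add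
      (((IsExpBounded.two_pow.mul (IsExpBounded.const 2)).mul (IsExpBounded.of_isPBounded hK)).mul
        (IsExpBounded.of_isPBounded (IsPBounded.add_holds hsbB (IsPBounded.const 1))))))).add
      IsExpBounded.two_pow)).add (IsExpBounded.isPBounded_comp (hpoly q) IsExpBounded.two_pow)
  obtain ⟨c₃, hc₃⟩ := (hΦd.mono (f := fun n =>
      24 * (2 * (2 * (n + 1) ^ D) + 4 * ((n + 1) ^ D + 2 ^ (n + 1) * (n + 1) ^ D * (A * ((n + 1) ^ D + 1) ^ a + 1)) +
        2 ^ n) + q.eval (2 ^ n)) fun n => by rw [pow_succ]).le_two_pow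
  obtain ⟨n₀, hn₀⟩ := eventually_atTop.1 hU
  set c := c₃ + c₁ + 2 with hc
  -- everything happens for all large `k`
  have hev : ∀ᶠ k : ℕ in atTop, max (max n₀ n₁) (max n₂ 1) ≤ Nat.nthRoot D k ∧
      ((2 ^ (c * Nat.nthRoot D k) : ℕ) : ℕ∞) < (⌈(2 : ℝ) ^ ((k : ℝ) ^ ε)⌉₊ : ℕ∞) :=
    ((tendsto_nthRoot hDpos.ne').eventually_ge_atTop _).and (eventually_two_pow_nthRoot_lt hDε c)
  refine hev.mono fun k hk => ?_
  obtain ⟨hkn, hfin⟩ := hk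
  refine lt_of_le_of_lt ?_ hfin
  -- the finite core, at this `k`
  simp only [max_le_iff] at hkn
  obtain ⟨⟨hkn₀, hkn₁⟩, hkn₂, hkn1⟩ := hkn
  have hk1 : 1 ≤ k := le_trans hkn1 (by
    have := Nat.pow_nthRoot_le (Or.inl hDpos.ne') (n := D) (a := k)
    calc Nat.nthRoot D k ≤ Nat.nthRoot D k ^ D := Nat.le_self_pow hDpos.ne' _
      _ ≤ k := this)
  obtain ⟨k', rfl⟩ : ∃ k', k = k' + 1 := ⟨k - 1, by omega⟩
  obtain ⟨m, hm⟩ : ∃ m, Nat.nthRoot D (k' + 1) = m + 1 := ⟨Nat.nthRoot D (k' + 1) - 1, by omega⟩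
  rw [hm] at hkn₀ hkn₁ hkn₂ ⊢
  have hkK : k' + 1 + 1 ≤ (m + 1 + 1) ^ D := by
    have := Nat.lt_pow_nthRoot_add_one hDpos.ne' (k' + 1)
    rw [hm] at this
    omega
  set sb := p.eval (k' + 1) with hsb
  have hsb_le : sb ≤ A * ((m + 1 + 1) ^ D + 1) ^ a :=
    (hA (k' + 1)).trans (Nat.mul_le_mul_left _ (Nat.pow_le_pow_left (by omega) a))
  have hg : ∀ (b : Bool) (j : Fin (k' + 1)),
      CktSize B2 (fun s (_ : Unit) => halfGen (G (k' + 1)) b s j) sb :=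
    fun b j => hp (k' + 1) (halfEquiv (k' + 1) (b, j))
  -- the threshold margin
  set η : ℝ := 1 / (4 * (2 : ℝ) ^ ((c₁ + 2) * (m + 1))) with hη
  have hη0 : 0 ≤ η := by rw [hη]; positivity
  have hX : (1 : ℝ) ≤ (2 : ℝ) ^ ((c₁ + 2) * (m + 1)) := one_le_pow₀ (by norm_num)
  have hηhalf : η < 1 / 2 := by
    rw [hη, one_div_lt_one_div (by positivity) (by norm_num)]
    linarith
  apply quantumPrgHardness_le_of_qtest (G (k' + 1)) (hp (k' + 1)) (F.circ (2 ^ (m + 1))) (hFfree _) hη0 hηhalf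
    (B := ((2 : ℝ) ^ (c₁ * (m + 1)))⁻¹)
  · -- threshold property of the amplified test
    intro w
    have hw : (fun t => (fun y => w (boolFunEquivFin (m + 1) y)) ((boolFunEquivFin (m + 1)).symm t)) = w :=
      funext fun t => by simp
    by_cases hmem : (fun y => w (boolFunEquivFin (m + 1) y)) ∈ P' (m + 1)
    · right
      have := (hF (m + 1) _).1 hmem
      rwa [hw] at this
    · left
      have := (hF (m + 1) _).2 hmem
      rwa [hw] at this
  · -- usefulness AT THE SINGLE EXPONENT `c₂`: the GGM functions have circuits of size `< n^{c₂}`, so they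
    -- are outside `P'` and the test accepts their truth tables with probability `≤ η`
    intro x
    refine (hF (m + 1) (fun y => ggmLab (halfGen (G (k' + 1))) x (m + 1) y 0)).2 fun hmem => ?_
    have hlt : (m + 1) ^ c₂ <
        circuitSizeOver B2 (fun y => ggmLab (halfGen (G (k' + 1))) x (m + 1) y 0) :=
      hn₀ (m + 1) hkn₀ _ (hP'P _ hmem)
    have hle := circuitSizeOver_ggm_le (halfGen (G (k' + 1))) hg x 0 (m + 1)
    have hΦ := hn₂ (m + 1) hkn₂
    have : (m + 1) * (2 * ((k' + 1) * sb) + (k' + 1) * 4) + 2 ≤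
        (m + 1) * (2 * ((m + 1 + 1) ^ D * (A * ((m + 1 + 1) ^ D + 1) ^ a)) +
          (m + 1 + 1) ^ D * 4) + 2 := by
      gcongr <;> omega
    omega
  · -- largeness: the test accepts a `2^{-c₁ n}` fraction of all truth tables with probability `≥ 1 - η`
    have h := hn₁ (m + 1) hkn₁
    have h' : (2 : ℝ) ^ 2 ^ (m + 1) ≤ 2 ^ (c₁ * (m + 1)) * Nat.card (P' (m + 1)) := by
      exact_mod_cast h
    rw [inv_mul_le_iff₀ (by positivity)]
    refine h'.trans ?_
    gcongr
    rw [← card_filter_mem_eq]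
    exact_mod_cast Finset.card_le_card fun f hf => by
      simp only [Finset.mem_filter, Finset.mem_univ, true_and] at hf ⊢
      exact (hF (m + 1) f).1 hf
  · -- size of the distinguisher
    calc 24 * (2 * (2 * (k' + 1)) + 4 * ((k' + 1) + 2 ^ (m + 1 + 1) * (k' + 1) * (sb + 1)) + 2 ^ (m + 1)) +
          (F.circ (2 ^ (m + 1))).size
        ≤ 24 * (2 * (2 * (m + 1 + 1) ^ D) + 4 * ((m + 1 + 1) ^ D +
            2 ^ (m + 1 + 1) * (m + 1 + 1) ^ D * (A * ((m + 1 + 1) ^ D + 1) ^ a + 1)) + 2 ^ (m + 1)) +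
            q.eval (2 ^ (m + 1)) := by
          gcongr
          · omega
          · omega
          · omega
          · exact (hq _).1
      _ ≤ 2 ^ (c₃ * (m + 1)) := hc₃ (m + 1) (by omega)
      _ ≤ 2 ^ (c * (m + 1)) := Nat.pow_le_pow_right (by norm_num) (by rw [hc]; nlinarith)
  · -- advantage versus `1/S`
    set n := m + 1 with hn
    set X : ℝ := (2 : ℝ) ^ ((c₁ + 1) * n) with hXdef
    have hXpos : 0 < X := by rw [hXdef]; positivity
    -- `B / (2ⁿ - 1) ≥ B / 2ⁿ = 1 / X`
    have hNle : ((2 ^ n - 1 : ℕ) : ℝ) ≤ 2 ^ n := by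
      have : 2 ^ n - 1 ≤ 2 ^ n := Nat.sub_le _ _
      exact_mod_cast this
    have hNpos : (0 : ℝ) < ((2 ^ n - 1 : ℕ) : ℝ) := by
      have : 0 < 2 ^ n - 1 := by
        have : 2 ≤ 2 ^ n := by
          calc (2:ℕ) = 2 ^ 1 := by norm_num
            _ ≤ 2 ^ n := Nat.pow_le_pow_right (by norm_num) (by omega)
        omega
      exact_mod_cast this
    have h3 : 1 / X ≤ ((2 : ℝ) ^ (c₁ * n))⁻¹ / (2 ^ n - 1 : ℕ) := by
      calc 1 / X = ((2 : ℝ) ^ (c₁ * n))⁻¹ / 2 ^ n := by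
            rw [hXdef, inv_eq_one_div, div_div, ← pow_add]; ring_nf
        _ ≤ ((2 : ℝ) ^ (c₁ * n))⁻¹ / (2 ^ n - 1 : ℕ) :=
            div_le_div_of_nonneg_left (by positivity) hNpos hNle
    -- `2η = 1/(2·2^{(c₁+2)n}) ≤ (1/X)/4`
    have h2 : 2 * η ≤ (1 / X) / 4 := by
      rw [hη, hXdef]
      have e1 : (2 : ℝ) ^ ((c₁ + 2) * n) = 2 ^ ((c₁ + 1) * n) * 2 ^ n := by
        rw [← pow_add]; ring_nf
      have hn2 : (2 : ℝ) ≤ 2 ^ n := by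
        calc (2 : ℝ) = 2 ^ 1 := by norm_num
          _ ≤ 2 ^ n := pow_le_pow_right₀ (by norm_num) (by omega)
      rw [e1, div_div, show 2 * (1 / (4 * (2 ^ ((c₁ + 1) * n) * (2 : ℝ) ^ n))) =
        1 / (2 * (2 ^ ((c₁ + 1) * n) * 2 ^ n)) by field_simp; ring]
      apply one_div_le_one_div_of_le (by positivity)
      nlinarith [hXpos]
    -- `1 / 2^{c n} ≤ (1/X)/2`
    have h1 : (1 : ℝ) / ((2 ^ (c * n) : ℕ) : ℝ) ≤ (1 / X) / 2 := by
      rw [hXdef, div_div, show ((2 ^ (c * n) : ℕ) : ℝ) = (2 : ℝ) ^ (c * n) by push_cast; ring]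
      apply one_div_le_one_div_of_le (by positivity)
      calc (2 : ℝ) ^ ((c₁ + 1) * n) * 2 = 2 ^ ((c₁ + 1) * n + 1) := by rw [pow_succ]
        _ ≤ 2 ^ (c * n) := pow_le_pow_right₀ (by norm_num) (by rw [hc]; nlinarith)
    have hXinv : 0 ≤ 1 / X := by positivity
    linarith

/-- **Natural proofs barrier for quantum-constructive properties** (Razborov–Rudich 1997, Thm. 4.1,
with the `B₂`-circuit test replaced by a quantum circuit reading the truth table as classical
input). If `Q` is a `BQP`-natural combinatorial property useful against `P/poly`, then EVERY
generator family `G = (Gₖ : {0,1}ᵏ → {0,1}²ᵏ)` computable in `P/poly` has QUANTUM hardness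
`H_q(Gₖ) < 2^{k^ε}` for infinitely many (indeed all large) `k`, for every `ε > 0` — i.e. no
`P/poly` generator is `2^{k^ε}`-hard against quantum circuits. Weak `∃ᶠ` form as in the tree
fact `Literature.Computability.Complexity.natural_proofs_barrier`; from the fixed-exponent form.
[cite: RazborovRudich1997, Thm. 4.1] [cite: ChiaChouZhangZhang2022, §4.1.2] [cite: ArunachalamGriloGurOliveiraSundaram2021, Def. 10 (§2.4)] -/
theorem quantum_natural_proofs_barrier (Q : CombinatorialProperty) (hN : IsNatural BQP Q)
    (hU : IsUsefulAgainstPPoly Q) (G : PRGFamily) (hG : G.IsInPPoly) {ε : ℝ} (hε : 0 < ε) :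
    ∃ᶠ k : ℕ in atTop, quantumPrgHardness (G k) < (⌈(2 : ℝ) ^ ((k : ℝ) ^ ε)⌉₊ : ℕ∞) := by
  obtain ⟨c, hc⟩ := quantum_natural_proofs_barrier_fixedExponent G hG hε
  exact (hc Q hN (hU c)).frequently

end Barrier

/-! ### The hypothesis, the catalogue entry, and the no-go theorems

**The hypothesis `QHG` (quantum-hard generators).** The no-go readings below are conditional on

  `∃ G : PRGFamily, G.IsInPPoly ∧ ∃ ε > 0, ∀ᶠ k, ⌈2^{k^ε}⌉₊ ≤ quantumPrgHardness (G k)`,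

"some generator family `Gₖ : {0,1}ᵏ → {0,1}²ᵏ` computable in `P/poly` is `2^{k^ε}`-hard against
QUANTUM circuits (oracle-free Clifford+`T`, classical input `|y⟩|0…0⟩`, read on wire `0`) for all
large `k`" — the hypothesis of Razborov–Rudich's Thm. 4.1 / Buss's SPRNG hypothesis (tree
`Literature.Barriers.PneNP.HardPRGExist`, `B₂`-circuit distinguishers) with the distinguishers of
Arunachalam–Grilo–Gur–Oliveira–Sundaram §2.6 ("`(s, ε)`-pseudorandom against quantum circuits … for
every quantum circuit `C` of size `s` defined over `m` input bits") and the quantum-secure generators of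
Chia–Chou–Zhang–Zhang Def. 4.2 ("a pseudorandom generator secure against quantum adversaries … for all
quantum polynomial-time algorithm `𝒜` … `|Pr[𝒜(G(x)) = 1] − Pr[𝒜(y) = 1]| ≤ ε(n)`", from
quantum-secure one-way functions by the black-box HILL construction, Lemma 4.4–4.5), in the
`2^{k^ε}`, non-uniform form of RR Thm. 4.1. It is a standard POST-QUANTUM cryptographic ASSUMPTION,
posed and never proved: Razborov–Rudich's own witnesses for the classical hypothesis, factoring and
discrete logarithm, are void against quantum circuits (Shor), and the candidates are lattice-based —
"the LWR problem immediately yields a simple and practical pseudorandom generator", "LWR may be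
exponentially hard (even for quantum algorithms) for any `p = poly(n)`", with pseudorandom FUNCTIONS
from LWE computable "in NC¹ or even TC⁰ … the first low-depth PRFs that have no known attack by
efficient quantum algorithms" (Banerjee–Peikert–Rosen 2012, abstract and §1.1; GGM/PRF security
against quantum adversaries from a quantum-secure generator: Zhandry 2012). Being unproved (indeed a
`2^{k^ε}` lower bound against quantum circuits for the range of `Gₖ`), it is NOT a Literature fact: the
theorems below take it as the explicit INLINE hypothesis `hq`, and it is to be registered BY NAME as the
obligation `QuantumHardPRGExist` in a conjecture leaf under `Summits/QuantumAdvantage/…/Theorems/`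
(CONVENTIONS §4), exactly as stated here. The barrier it feeds, `QuantumNaturalProofs`, IS proved
(`QuantumNaturalProofs_holds`). -/

section Entry

/-- **Natural proofs barrier for QUANTUM natural properties (Razborov–Rudich 1997, Thm. 4.1, with
a quantum test; the `Γ = BQP` case not covered by the entry `NaturalProofs` / `NaturalProofsNarrow`).**
If `Q` is a `BQP`-natural combinatorial property (tree `IsNatural BQP Q`: it contains a large
sub-property whose truth-table language is decided in bounded-error quantum polynomial time in
`N = 2ⁿ` — a "quantum natural property", Arunachalam et al. Def. 10 with `𝔇 = BQP`) useful against
`P/poly` (tree `IsUsefulAgainstPPoly Q`), then EVERY generator family in `P/poly` has QUANTUM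
hardness `H_q(Gₖ) < 2^{k^ε}` for infinitely many `k`, for every `ε > 0`; contrapositively
(`no_quantumNatural_of_qHardPRG`): if a `2^{k^ε}`-quantum-hard generator in `P/poly` exists
(hypothesis `QHG` of the section docstring, to be registered as `QuantumHardPRGExist`) there is NO
quantum natural property useful against `P/poly` — the door
`exists_mem_bqp_not_mem_bpp_of_quantumNatural` / right disjunct of `quantumNatural_dichotomy` of
`NaturalProofsScope.lean` is empty. PROVED in this file (`QuantumNaturalProofs_holds`, from
`quantum_natural_proofs_barrier`).

BARRIER
technique_class: quantum-natural-proofs, bqp-natural-properties, bqp-constructive-large-properties, natural-proofs-with-constructivity-in-P-BPP-EQP-or-BQP, mqcsp-in-bqp, quantum-algorithms-deciding-dense-properties-of-truth-tables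
blocks: under `QHG` (a `2^{k^ε}`-quantum-hard generator family in `P/poly`), every lower-bound argument for `BQP ⊄ P/poly` (route `CircuitLB`), for `FACT ∉ P/poly`, or for `L ∉ P/poly` with any explicit `L`, whose exhibited property of the hard function is (contained in) a LARGE property with a `Γ`-CONSTRUCTIVE large sub-property for some `Γ ⊆ BQP` — `Γ = BQP` (`no_quantumNatural_of_qHardPRG`), `Γ = P`, `Γ = BPP` (`no_natural_of_subset_BQP` with `P_subset_BQP_holds`, `BPP_subset_BQP_holds`) — or for some `Γ ⊆ P/poly` (the classical entry `Literature.Barriers.PneNP.NaturalProofs`, whose hypothesis `HardPRGExist` follows from `QHG` by `hardPRGExist_of_qHardPRG`: `no_naturalProof_of_qHardPRG`), and useful against `P/poly`, indeed already against the single size bound `n^c` for the exponent `c` of the generator (`exists_exponent_no_quantumNatural_of_qHardPRG`) [cite: RazborovRudich1997, Thm. 4.1] [cite: AroraBarakCC2009, Thm. 23.1 (PDF p. 587)]; in particular the candidate door "a `BQP`-natural property useful against `P/poly` yields `∃ L ∈ BQP, L ∉ BPP`" (`Literature.Barriers.QuantumAdvantage.exists_mem_bqp_not_mem_bpp_of_quantumNatural`,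 `quantumNatural_dichotomy`) carries nothing under this hypothesis (`quantumNatural_door_closed`), and "`MCSP[n^c] ∈ BQP`"-type algorithms for the truth-table property "circuit size `> n^c`" (large, useful against `SIZE(n^c)`) are excluded for that `c` — the quantum Kabanets–Cai reading "if `MQCSP ∈ BQP` then quantum-secure one-way functions do not exist" [cite: ChiaChouZhangZhang2022, Thm. 1.4 (§4.1.2)] [cite: KabanetsCai2000, §2].
because: a `BQP`-constructive large property gives a uniform Clifford+`T` family deciding truth tables (length `N = 2ⁿ`) with error `1/3`, amplified by majority vote over polynomially many copies to error `2^{-(c₁+2)n}/4` (`qtest_of_isConstructive`) [cite: BennettBernsteinBrassardVazirani1997, Thm. 4.13]; it accepts a `2^{-c₁ n}` fraction of all truth tables with probability `≥ 1 - η` and, by usefulness, the truth table of every Goldreich–Goldwasser–Micali function `y ↦ bit₀(G_y(x))` on `n = ⌊k^{1/D}⌋` variables (circuit size `poly(k)·n ≤ n^{c}`) with probability `≤ η`; the hybrid argument over the `2ⁿ - 1` internal nodes of the GGM tree, run on the Boolean event "accepted with probability `≥ 1 - η`" (tree `Literature.Computability.MetaComplexity.exists_distinguisher`), fixes a node and the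 fresh labels, and the quantum circuit "compute the truth table of the hybrid from the challenge `z ∈ {0,1}²ᵏ` by a reversible `NOT`/`CNOT`/Toffoli program (classical input read classically — no superposition query to the function is ever made), then run the test on it" (`QDist.Params.circuit`, `quantumPrgHardness_le_of_qtest`) has size `2^{O(n)} < 2^{k^ε}` and advantage `≥ 2^{-c₁n}/(2ⁿ-1) - 2η ≥ 2^{-O(n)} > 2^{-k^ε}` against `Gₖ` [cite: RazborovRudich1997, Thm. 4.1 (proof)] [cite: AroraBarakCC2009, §23.3 (PDF pp. 591–592)] [cite: ChiaChouZhangZhang2022, §4.1.1 Lemma 4.6 (the hybrid Ĝ^i) and §4.1.2 Algorithm 1 ("Given T(h) … runs the quantum algorithm")] [cite: NielsenChuang2010, §3.2.5 and §4.3 (reversible classical computation inside a quantum circuit)].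
evasions_known: (1) THE HYPOTHESIS MAY FAIL — `QHG` is a post-quantum assumption: the classical entry's named witnesses, factoring and discrete logarithm [cite: AroraBarakCC2009, Ch. 23 introduction (PDF p. 586)], are broken by quantum circuits (Shor; tree `Literature.Computability.Cryptography.FACT_mem_BQP`) [cite: Shor1997, §5–§6], so only lattice/LWE/LWR-type generators support it [cite: BanerjeePeikertRosen2012, abstract and §1.1] [cite: Zhandry2012, abstract]; if it fails nothing here is barred, and a quantum natural property useful against `P/poly` would then be a quantum attack on every `P/poly` generator (`quantum_natural_proofs_barrier` read directly, RR's "self-defeating" reading; `not_quantumHard_of_quantumNatural`) [cite: RazborovRudich1997, Thm. 4.1]. (2) CONSTRUCTIVITY BEYOND `BQP`: `QMA`-, `QCMA/qpoly`-, `NP̃/qpoly`-natural properties are untouched (the latter excluded only under Rudich's super-bit hypothesis) [cite: Rudich1997, abstract, §3.4 (Conj. 1), §5.1 (Conj. 3), §5.4 (Thm. 6)], and `coNP`-natural properties useful against `P/poly` exist outright [cite: Williams2016NaturalVsDerandomization, §1 (discussion after Thm. 1.6)]. (3) PROMISE quantum natural properties and quantum LEARNERS: Arunachalam et al. work with promise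 `BQP`-natural properties (a quantum algorithm accepting a dense set and rejecting easy functions, unconstrained elsewhere) obtained from quantum learning algorithms, and transfer them UNCONDITIONALLY to lower bounds `BQE ⊄ 𝒞[n^b]` (a win-win with a conditional PRG) — a live programme, "Is there a (promise) quantum natural property useful against `ACC⁰` circuits?" [cite: ArunachalamGriloGurOliveiraSundaram2021, Def. 12 (§2.4), §3.2 (Lemma 20, Thm. 21) and §1.4 (Question 2)] [cite: ChiaChouZhangZhang2022, Observation 1 (§3.1)]; usefulness against restricted classes `𝒞 ⊊ P/poly` without quantum-secure PRFs in `𝒞` is not barred (but `TC⁰` already hosts LWE-based PRF candidates with no known quantum attack) [cite: BanerjeePeikertRosen2012, abstract and §1.1]. (4) As for the classical entry: NON-LARGE properties (diagonalization, the singleton `{3SAT}`, function-specific structure) and NON-CONSTRUCTIVE combinatorics [cite: AroraBarakCC2009, §23.4–§23.5 (PDF pp. 592–595) and Example 23.2 (PDF p. 587)], almost-natural proofs [cite: Chow2011, abstract and §1], and the uniform summit `BQP ⊄ BPP` itself, which is no circuit lower bound; conditional routes taking `FACT ∉ BPP` / `FACT ∉ P/poly` as hypotheses are untouched [cite: AroraBarakCC2009,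 Thm. 23.1 (a constraint on proofs, under an assumption)].
scope_caveats: CONDITIONAL on `QHG` (an unproved post-quantum hypothesis, taken inline), which is at least as strong as the classical hypothesis: `QHG` ⟹ `Literature.Barriers.PneNP.HardPRGExist` (a `B₂`-circuit test is a quantum test, `hardPRGExist_of_qHardPRG`, exponent `ε/2`), so under `QHG` the classical entry applies too and `P/poly`-natural properties useful against `P/poly` are excluded as well (`no_naturalProof_of_qHardPRG`); the converse implication is not claimed [cite: RazborovRudich1997, Thm. 4.1]; "quantum natural" means the tree's `IsConstructive BQP` — the truth-table language decided by a polynomial-time UNIFORM oracle-free Clifford+`T` family with two-sided error `1/3` on EVERY input (Arunachalam et al. Def. 10 with `𝔇 = BQP`; CCZZ Def. 3.6–3.7): PROMISE natural properties (Def. 12: acceptance probabilities unconstrained off the dense set and the easy functions) are NOT covered by the proof given here, which thresholds the amplified test and needs the two-sided error bound on all truth tables (the hybrid argument run on expectations would cover them; not formalized) [cite: ArunachalamGriloGurOliveiraSundaram2021, Def. 10–12 (§2.4)], nor are non-uniform quantum constructivity classes (`BQP/poly`, `BQP/qpoly`; the proof uses uniformity only to bound the circuit size polynomially, so `BQP/poly`-constructivity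 with an explicit polynomial size bound goes through verbatim — not stated); the printed quantum statement is the POLYNOMIAL, uniform regime ("`MQCSP ∈ BQP` ⟹ no quantum-secure one-way function": QPT adversaries, negligible advantage, truth tables of length `2^m = poly(n)`) whereas this entry is RR's `2^{k^ε}`/`2^{-O(n)}`-largeness regime with non-uniform quantum circuit distinguishers fed classical input [cite: ChiaChouZhangZhang2022, Thm. 1.4 and §4.1.2] [cite: ArunachalamGriloGurOliveiraSundaram2021, §2.6]; hardness counts Clifford+`T` gates of oracle-free circuits with any number of zero ancillas, acceptance on wire `0` (`quantumPrgHardness`); usefulness is the tree's per-length a.e. form, largeness `2^{-O(n)}`, circuit size over `B₂` (`IsUsefulAgainstSize`, `IsLarge`); the conclusion is the weak `∃ᶠ k` form (all large `k` in the proof); fixed-exponent form `exists_exponent_no_quantumNatural_of_qHardPRG` as in Arora–Barak Thm. 23.1 [cite: AroraBarakCC2009, Thm. 23.1 (PDF p. 587)].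
status: established — proved in the tree (`QuantumNaturalProofs_holds`) [cite: RazborovRudich1997, Thm. 4.1] [cite: ChiaChouZhangZhang2022, Thm. 1.4 (§4.1.2)] -/
def QuantumNaturalProofs : Prop :=
  ∀ (Q : CombinatorialProperty), IsNatural BQP Q → IsUsefulAgainstPPoly Q →
    ∀ (G : PRGFamily), G.IsInPPoly → ∀ (ε : ℝ), 0 < ε →
      ∃ᶠ k : ℕ in atTop, quantumPrgHardness (G k) < (⌈(2 : ℝ) ^ ((k : ℝ) ^ ε)⌉₊ : ℕ∞)

/-- **The quantum natural proofs barrier holds** (D-0014 discharge): it is the theorem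
`quantum_natural_proofs_barrier` of this file. [cite: RazborovRudich1997, Thm. 4.1] [cite: ChiaChouZhangZhang2022, Thm. 1.4 (§4.1.2)] -/
theorem QuantumNaturalProofs_holds : QuantumNaturalProofs :=
  fun Q hN hU G hG _ hε => quantum_natural_proofs_barrier Q hN hU G hG hε

/-- **No quantum natural property useful against `P/poly` if quantum-hard generators exist**
(the `Γ = BQP` analogue of `Literature.Barriers.PneNP.NaturalProofs.not_exists_naturalProof`):
if some generator family in `P/poly` has quantum hardness `≥ 2^{k^ε}` for all large `k` (`QHG`),
no combinatorial property is both `BQP`-natural and useful against `P/poly`. Proof: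
"`H_q(Gₖ) < 2^{k^ε}` infinitely often" meets "`H_q(Gₖ) ≥ 2^{k^ε}` eventually".
[cite: RazborovRudich1997, Thm. 4.1] [cite: ChiaChouZhangZhang2022, Thm. 1.4 (§4.1.2)] [cite: ArunachalamGriloGurOliveiraSundaram2021, Def. 10 (§2.4)] -/
theorem no_quantumNatural_of_qHardPRG
    (hq : ∃ G : PRGFamily, G.IsInPPoly ∧ ∃ ε : ℝ, 0 < ε ∧
      ∀ᶠ k : ℕ in atTop, (⌈(2 : ℝ) ^ ((k : ℝ) ^ ε)⌉₊ : ℕ∞) ≤ quantumPrgHardness (G k)) :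
    ¬ ∃ Q : CombinatorialProperty, IsNatural BQP Q ∧ IsUsefulAgainstPPoly Q := by
  rintro ⟨Q, hN, hU⟩
  obtain ⟨G, hGP, ε, hε, hk⟩ := hq
  obtain ⟨k, hlt, hle⟩ := ((quantum_natural_proofs_barrier Q hN hU G hGP hε).and_eventually hk).exists
  exact lt_irrefl _ (hlt.trans_le hle)

/-- **Fixed-exponent form** (Arora–Barak Thm. 23.1 shape): under `QHG` there is a constant `c` —
depending on the quantum-hard generator and its `ε` only — such that NO `BQP`-natural property is
useful even against the single size bound `n^c`. [cite: AroraBarakCC2009, Thm. 23.1 (PDF p. 587)] [cite: RazborovRudich1997, Thm. 4.1] -/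
theorem exists_exponent_no_quantumNatural_of_qHardPRG
    (hq : ∃ G : PRGFamily, G.IsInPPoly ∧ ∃ ε : ℝ, 0 < ε ∧
      ∀ᶠ k : ℕ in atTop, (⌈(2 : ℝ) ^ ((k : ℝ) ^ ε)⌉₊ : ℕ∞) ≤ quantumPrgHardness (G k)) :
    ∃ c : ℕ, ¬ ∃ Q : CombinatorialProperty, IsNatural BQP Q ∧ IsUsefulAgainstSize (fun n => n ^ c) Q := by
  obtain ⟨G, hG, ε, hε, hk⟩ := hq
  obtain ⟨c, hc⟩ := quantum_natural_proofs_barrier_fixedExponent G hG hε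
  refine ⟨c, fun ⟨Q, hN, hU⟩ => ?_⟩
  obtain ⟨k, hlt, hle⟩ := ((hc Q hN hU).and hk).exists
  exact lt_irrefl _ (hlt.trans_le hle)

/-- **Every constructivity class inside `BQP` is covered**: under `QHG` there is no `Γ`-natural
property useful against `P/poly` for any `Γ ⊆ BQP` (`IsNatural.mono_class`) — in particular none
for `Γ = P` (`Literature.Computability.Cryptography.P_subset_BQP_holds`) and none for `Γ = BPP`,
randomized natural properties (`Literature.Computability.QuantumComplexity.BPP_subset_BQP_holds`).
[cite: RazborovRudich1997, Thm. 4.1 and §2 (Γ-naturality is monotone in Γ)] [cite: BernsteinVazirani1997, §8 (P ⊆ BQP, BPP ⊆ BQP)] -/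
theorem no_natural_of_subset_BQP
    (hq : ∃ G : PRGFamily, G.IsInPPoly ∧ ∃ ε : ℝ, 0 < ε ∧
      ∀ᶠ k : ℕ in atTop, (⌈(2 : ℝ) ^ ((k : ℝ) ^ ε)⌉₊ : ℕ∞) ≤ quantumPrgHardness (G k))
    {Γ : Set (Language Bool)} (hΓ : Γ ⊆ BQP) :
    ¬ ∃ Q : CombinatorialProperty, IsNatural Γ Q ∧ IsUsefulAgainstPPoly Q :=
  fun ⟨Q, hN, hU⟩ => no_quantumNatural_of_qHardPRG hq ⟨Q, hN.mono_class hΓ, hU⟩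

/-- `Γ = P` under the quantum hypothesis `QHG`. [cite: RazborovRudich1997, Thm. 4.1] [cite: BernsteinVazirani1997, Thm. 8.2 (P ⊆ BQP)] -/
theorem no_pNatural_of_qHardPRG
    (hq : ∃ G : PRGFamily, G.IsInPPoly ∧ ∃ ε : ℝ, 0 < ε ∧
      ∀ᶠ k : ℕ in atTop, (⌈(2 : ℝ) ^ ((k : ℝ) ^ ε)⌉₊ : ℕ∞) ≤ quantumPrgHardness (G k)) :
    ¬ ∃ Q : CombinatorialProperty, IsNatural Classes.P Q ∧ IsUsefulAgainstPPoly Q :=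
  no_natural_of_subset_BQP hq P_subset_BQP_holds

/-- `Γ = BPP` (randomized natural properties) under the quantum hypothesis `QHG`.
[cite: RazborovRudich1997, Thm. 4.1] [cite: BernsteinVazirani1997, §8 (BPP ⊆ BQP)] -/
theorem no_bppNatural_of_qHardPRG
    (hq : ∃ G : PRGFamily, G.IsInPPoly ∧ ∃ ε : ℝ, 0 < ε ∧
      ∀ᶠ k : ℕ in atTop, (⌈(2 : ℝ) ^ ((k : ℝ) ^ ε)⌉₊ : ℕ∞) ≤ quantumPrgHardness (G k)) :
    ¬ ∃ Q : CombinatorialProperty, IsNatural BPP Q ∧ IsUsefulAgainstPPoly Q :=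
  no_natural_of_subset_BQP hq BPP_subset_BQP_holds

/-- **The door of `NaturalProofsScope` is closed under the quantum hypothesis.** The right disjunct
of `quantumNatural_dichotomy` ("every `BQP`-natural property useful against `P/poly` yields
`∃ L ∈ BQP, L ∉ BPP`") quantifies over the empty set when `QHG` holds: no `BQP`-natural property is
useful against `P/poly`. [cite: RazborovRudich1997, Thm. 4.1] [cite: ChiaChouZhangZhang2022, Thm. 1.4 (§4.1.2)] -/
theorem quantumNatural_door_closed
    (hq : ∃ G : PRGFamily, G.IsInPPoly ∧ ∃ ε : ℝ, 0 < ε ∧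
      ∀ᶠ k : ℕ in atTop, (⌈(2 : ℝ) ^ ((k : ℝ) ^ ε)⌉₊ : ℕ∞) ≤ quantumPrgHardness (G k))
    (Q : CombinatorialProperty) (hN : IsNatural BQP Q) : ¬ IsUsefulAgainstPPoly Q :=
  fun hU => no_quantumNatural_of_qHardPRG hq ⟨Q, hN, hU⟩

/-- **What a quantum natural property WOULD prove** (the theorem read directly, RR's "self-defeating"
reading in the quantum world): a `BQP`-natural property useful against `P/poly` refutes `QHG`, i.e.
it is a `2^{k^ε}`-quantum-distinguisher, for every `ε`, against every generator family in `P/poly`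
— a statement about post-quantum cryptography, not (as for the classical hypothesis,
`not_bqp_subset_PPoly_of_quantumNatural`) a circuit lower bound for `BQP`.
[cite: RazborovRudich1997, Thm. 4.1] [cite: ChiaChouZhangZhang2022, Thm. 1.4 (§4.1.2)] -/
theorem not_quantumHard_of_quantumNatural {Q : CombinatorialProperty} (hN : IsNatural BQP Q)
    (hU : IsUsefulAgainstPPoly Q) :
    ¬ ∃ G : PRGFamily, G.IsInPPoly ∧ ∃ ε : ℝ, 0 < ε ∧
      ∀ᶠ k : ℕ in atTop, (⌈(2 : ℝ) ^ ((k : ℝ) ^ ε)⌉₊ : ℕ∞) ≤ quantumPrgHardness (G k) :=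
  fun hq => no_quantumNatural_of_qHardPRG hq ⟨Q, hN, hU⟩

end Entry

/-! ### A `B₂`-circuit test is a quantum test: `QHG` implies `HardPRGExist`

The classical distinguishers of Razborov–Rudich's `H(G)` (tree `prgHardness`) are among the quantum
ones of `H_q(G)` (`quantumPrgHardness`) up to the linear overhead of compiling a `B₂`-circuit into
`NOT`/`CNOT`/Toffoli gates over Clifford+`T` (Nielsen–Chuang §3.2.5, §4.3; here `RevB2.compile` and
`QDist.Params.circuit` with the EMPTY one-wire test "measure wire `0`"). Consequently
`H(G) ≥ (H_q(G) − 24(2m+1))/96`, the quantum hypothesis `QHG` implies the classical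
`Literature.Barriers.PneNP.HardPRGExist` (with `ε/2` in place of `ε`), and under `QHG` the classical
entry applies as well: there is no natural proof in Razborov–Rudich's widest, `P/poly`-constructive
sense either (`no_naturalProof_of_qHardPRG`). -/

section ClassicalTest

/-- The trivial one-wire quantum test — the empty circuit on `1 + 0` wires followed by the
measurement of wire `0` — accepts the basis state `|b⟩` with probability `b`. [folklore] -/
theorem acceptProb_nil_fin_one (v : Fin 1 → Bool) :
    (⟨[]⟩ : QCircuit cliffordT (1 + 0)).acceptProb 0 v = if v 0 then 1 else 0 := by
  have h1 : 0 < 1 + 0 := Nat.one_pos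
  unfold QCircuit.acceptProb
  simp only [h1, dif_pos]
  rw [QCircuit.runOn, QCircuit.toMatrix_nil, Matrix.one_mulVec]
  have hpad : padInput v 0 ⟨0, h1⟩ = v 0 := padInput_apply_of_lt' v 0 ⟨0, h1⟩ Nat.one_pos
  rw [Finset.sum_eq_single (padInput v 0)]
  · rw [hpad, basisState_apply, if_pos rfl]
    split_ifs <;> simp
  · intro y _ hy
    rw [basisState_apply, if_neg hy]
    split_ifs <;> simp
  · intro h
    exact absurd (Finset.mem_univ _) h

/-- **A `B₂`-circuit test is a quantum test.** If a `B₂`-circuit `C` on `m > 0` input bits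
distinguishes `g : {0,1}ᵏ → {0,1}ᵐ` from uniform with advantage `≥ 1/S`, where
`S ≥ 24·(2m + 4|C| + 1)`, then `H_q(g) ≤ S`: the oracle-free Clifford+`T` circuit "compute `C(z)`
from the classical input `|z⟩|0…0⟩` by a reversible `NOT`/`CNOT`/Toffoli program (`RevB2.compile`),
copy the result onto wire `0`, measure wire `0`" (`QDist.Params.circuit` with the empty one-wire
test) accepts `z` with probability exactly `C(z) ∈ {0,1}` (`QDist.Params.acceptProb_circuit`,
`acceptProb_nil_fin_one`), so its quantum advantage against `g` equals the advantage of `C`, and it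
has at most `24·(2m + 4|C| + 1)` gates (`QDist.Params.size_circuit_le`).
[cite: NielsenChuang2010, §3.2.5 and §4.3 (reversible simulation of classical circuits inside a quantum circuit)] [cite: RazborovRudich1997, §4 (definition of H(G))] [cite: ArunachalamGriloGurOliveiraSundaram2021, §2.6] -/
theorem quantumPrgHardness_le_of_circuit {k m : ℕ} (hm : 0 < m)
    (g : (Fin k → Bool) → (Fin m → Bool)) (C : Circuit (Fin m)) (hC : C.IsOver B2) {S : ℕ}
    (hS : 24 * (2 * m + 4 * C.size + 1) ≤ S) (hadv : (1 : ℝ) / S ≤ prgAdvantage C g) :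
    quantumPrgHardness g ≤ S := by
  classical
  obtain ⟨gs, out, hlen, hreal⟩ := (C.cktSize_eval hC).outMap (fun _ : Fin 1 => ())
  let P : QDist.Params := ⟨m, 1, 0, ⟨[]⟩, gs, out, _, hreal, hm, Nat.one_pos⟩
  have hL : P.L ≤ C.size := hlen
  have hsize : P.circuit.size ≤ S :=
    P.size_circuit_le.trans (le_trans (by change 24 * (2 * m + 4 * P.L + 1) + 0 ≤ _; omega) hS)
  have hSpos : 0 < S := by omega
  have hOF : P.Tq.IsOracleFree := fun g hg => absurd hg List.not_mem_nil
  refine quantumPrgHardness_le hSpos P.circuit (P.circuit_isOracleFree hOF) hsize ?_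
  -- the acceptance probabilities of the quantum circuit are the values of `C`
  have hacc : ∀ z : Fin m → Bool, P.circuit.acceptProb 0 z = if C.eval z then 1 else 0 := fun z => by
    rw [P.acceptProb_circuit z]
    exact acceptProb_nil_fin_one _
  have e1 : (∑ s : Fin k → Bool, P.circuit.acceptProb 0 (g s)) =
      ((Finset.univ.filter fun s : Fin k → Bool => C.eval (g s) = true).card : ℝ) := by
    simp only [hacc]
    rw [Finset.sum_boole]
  have e2 : (∑ y : Fin m → Bool, P.circuit.acceptProb 0 y) =
      ((Finset.univ.filter fun y : Fin m → Bool => C.eval y = true).card : ℝ) := by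
    simp only [hacc]
    rw [Finset.sum_boole]
  rw [quantumPrgAdvantage, e1, e2]
  exact hadv

/-- **Quantum hardness bounds classical hardness from below, up to the compilation overhead**:
if `H_q(g) ≥ N ≥ 24·(2m + 4N' + 1)` (`m > 0`) then `H(g) ≥ N'` — a `B₂`-distinguisher of size
`≤ S < N'` with advantage `≥ 1/S` would compile (`quantumPrgHardness_le_of_circuit`) into a quantum
distinguisher of size `≤ 24·(2m + 4S + 1) < N` with the same advantage.
[cite: RazborovRudich1997, §4 (definition of H(G))] [cite: NielsenChuang2010, §4.3] -/
theorem le_prgHardness_of_le_quantumPrgHardness {k m : ℕ} (hm : 0 < m)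
    (g : (Fin k → Bool) → (Fin m → Bool)) {N N' : ℕ} (hN : 24 * (2 * m + 4 * N' + 1) ≤ N)
    (hq : (N : ℕ∞) ≤ quantumPrgHardness g) : (N' : ℕ∞) ≤ prgHardness g := by
  unfold prgHardness
  refine le_iInf fun S => le_iInf fun hS => le_iInf fun hex => ?_
  obtain ⟨C, hC, hsz, hadv⟩ := hex
  by_contra hlt
  have hlt' : S < N' := by
    have : (S : ℕ∞) < N' := lt_of_not_ge hlt
    exact_mod_cast this
  have h1 : (1 : ℝ) / (24 * (2 * m + 4 * S + 1) : ℕ) ≤ 1 / S :=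
    one_div_le_one_div_of_le (by exact_mod_cast hS)
      (by exact_mod_cast (show S ≤ 24 * (2 * m + 4 * S + 1) by omega))
  have hle : quantumPrgHardness g ≤ (24 * (2 * m + 4 * S + 1) : ℕ) :=
    quantumPrgHardness_le_of_circuit hm g C hC (by omega) (h1.trans hadv)
  have h2 : N ≤ 24 * (2 * m + 4 * S + 1) := by exact_mod_cast hq.trans hle
  omega

/-- `k ≤ 2^{k^δ}` for all large `k` when `δ > 0` (since `log k = o(k^δ)`). [folklore] -/
theorem eventually_natCast_le_two_rpow {δ : ℝ} (hδ : 0 < δ) :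
    ∀ᶠ k : ℕ in atTop, (k : ℝ) ≤ (2 : ℝ) ^ ((k : ℝ) ^ δ) := by
  have h := ((isLittleO_log_rpow_atTop hδ).comp_tendsto tendsto_natCast_atTop_atTop).def
    (Real.log_pos one_lt_two)
  filter_upwards [h, eventually_gt_atTop 0] with k hk hk0
  have hkpos : (0 : ℝ) < k := by exact_mod_cast hk0
  have h1 : Real.log k ≤ Real.log 2 * (k : ℝ) ^ δ := by
    have h2 : ‖Real.log (k : ℝ)‖ ≤ Real.log 2 * ‖(k : ℝ) ^ δ‖ := hk
    rw [Real.norm_eq_abs, Real.norm_eq_abs, abs_of_nonneg (by positivity : (0 : ℝ) ≤ (k : ℝ) ^ δ)] at h2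
    exact (le_abs_self _).trans h2
  calc (k : ℝ) = Real.exp (Real.log k) := (Real.exp_log hkpos).symm
    _ ≤ Real.exp (Real.log 2 * (k : ℝ) ^ δ) := Real.exp_le_exp.2 h1
    _ = (2 : ℝ) ^ ((k : ℝ) ^ δ) := by rw [Real.rpow_def_of_pos (by norm_num : (0 : ℝ) < 2)]

/-- The size slack of the compilation: `24·(4k + 4⌈2^{k^{ε/2}}⌉₊ + 1) ≤ ⌈2^{k^ε}⌉₊` for all
large `k` (`ε > 0`), since `2^{k^ε} = (2^{k^{ε/2}})^{k^{ε/2}}` and `k ≤ 2^{k^{ε/2}}` eventually.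
[folklore] -/
theorem eventually_overhead_le_ceil {ε : ℝ} (hε : 0 < ε) :
    ∀ᶠ k : ℕ in atTop, 24 * (2 * (2 * k) + 4 * ⌈(2 : ℝ) ^ ((k : ℝ) ^ (ε / 2))⌉₊ + 1) ≤
      ⌈(2 : ℝ) ^ ((k : ℝ) ^ ε)⌉₊ := by
  have hε2 : 0 < ε / 2 := half_pos hε
  have ht : Tendsto (fun k : ℕ => (k : ℝ) ^ (ε / 2)) atTop atTop :=
    (tendsto_rpow_atTop hε2).comp tendsto_natCast_atTop_atTop
  filter_upwards [ht.eventually_ge_atTop 4, eventually_natCast_le_two_rpow hε2, eventually_gt_atTop 0]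
    with k hk4 hk2 hk0
  have hkpos : (0 : ℝ) < k := by exact_mod_cast hk0
  have hk4' : (4 : ℝ) ≤ (k : ℝ) ^ (ε / 2) := hk4
  set t : ℝ := (k : ℝ) ^ (ε / 2) with ht_def
  set a : ℝ := (2 : ℝ) ^ t with ha_def
  have ha1 : 1 ≤ a := Real.one_le_rpow one_le_two (by linarith)
  have hεt : (k : ℝ) ^ ε = t * t := by
    rw [ht_def, ← Real.rpow_add hkpos]
    congr 1
    ring
  have hb : (2 : ℝ) ^ (t + 9) ≤ (2 : ℝ) ^ ((k : ℝ) ^ ε) := by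
    rw [hεt]
    exact Real.rpow_le_rpow_of_exponent_le one_le_two (by nlinarith)
  have h29 : (2 : ℝ) ^ (t + 9) = 512 * a := by
    rw [Real.rpow_add two_pos, ha_def, show (9 : ℝ) = ((9 : ℕ) : ℝ) by norm_num, Real.rpow_natCast]
    norm_num
    ring
  have hceil : (⌈a⌉₊ : ℝ) < a + 1 := Nat.ceil_lt_add_one (by positivity)
  have key : ((24 * (2 * (2 * k) + 4 * ⌈a⌉₊ + 1) : ℕ) : ℝ) ≤ (2 : ℝ) ^ ((k : ℝ) ^ ε) := by
    push_cast
    have hka : (k : ℝ) ≤ a := hk2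
    linarith
  exact_mod_cast key.trans (Nat.le_ceil _)

/-- **`QHG` implies `HardPRGExist`**: a generator family in `P/poly` that is `2^{k^ε}`-hard
against QUANTUM circuits is `2^{k^{ε/2}}`-hard against `B₂`-circuits
(`le_prgHardness_of_le_quantumPrgHardness`, `eventually_overhead_le_ceil`), so the quantum
hypothesis is at least as strong as Razborov–Rudich's / Buss's SPRNG hypothesis
`Literature.Barriers.PneNP.HardPRGExist`. [cite: RazborovRudich1997, Thm. 4.1 (hypothesis) and §4] [cite: NielsenChuang2010, §4.3] -/
theorem hardPRGExist_of_qHardPRG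
    (hq : ∃ G : PRGFamily, G.IsInPPoly ∧ ∃ ε : ℝ, 0 < ε ∧
      ∀ᶠ k : ℕ in atTop, (⌈(2 : ℝ) ^ ((k : ℝ) ^ ε)⌉₊ : ℕ∞) ≤ quantumPrgHardness (G k)) :
    Literature.Barriers.PneNP.HardPRGExist := by
  obtain ⟨G, hGP, ε, hε, hk⟩ := hq
  refine ⟨G, hGP, ε / 2, half_pos hε, ?_⟩
  filter_upwards [hk, eventually_overhead_le_ceil hε, eventually_gt_atTop 0] with k hk hsl hk0
  exact le_prgHardness_of_le_quantumPrgHardness (by omega) (G k) hsl hk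

/-- **Under `QHG` the classical barrier applies too**: no natural proof in Razborov–Rudich's widest
sense (`Literature.Barriers.PneNP.IsNaturalProof`: `P/poly`-natural and useful against `P/poly`)
exists — the classical entry `Literature.Barriers.PneNP.NaturalProofs` (proved in the tree,
`natural_proofs_barrier_holds`) fed the classical hypothesis obtained from `QHG`
(`hardPRGExist_of_qHardPRG`). Together with `no_natural_of_subset_BQP` this covers every
constructivity class `Γ ⊆ P/poly ∪ BQP`-wise: `Γ ⊆ P/poly` here, `Γ ⊆ BQP` there.
[cite: RazborovRudich1997, Thm. 4.1] [cite: AroraBarakCC2009, Thm. 23.1 (PDF p. 587)] -/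
theorem no_naturalProof_of_qHardPRG
    (hq : ∃ G : PRGFamily, G.IsInPPoly ∧ ∃ ε : ℝ, 0 < ε ∧
      ∀ᶠ k : ℕ in atTop, (⌈(2 : ℝ) ^ ((k : ℝ) ^ ε)⌉₊ : ℕ∞) ≤ quantumPrgHardness (G k)) :
    ¬ ∃ Q : CombinatorialProperty, Literature.Barriers.PneNP.IsNaturalProof Q :=
  (Literature.Barriers.PneNP.naturalProofs_iff.2 natural_proofs_barrier_holds).not_exists_naturalProof
    (hardPRGExist_of_qHardPRG hq)

end ClassicalTest





end Literature.Barriers.QuantumAdvantage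

end
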